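import Literature.NumberTheory.ModularSymbols.CuspidalHomologyPrymFixedPointSpan
import Literature.NumberTheory.EllipticCurves.HidaOrdinaryCohomologyCocycles
import Literature.NumberTheory.QuadraticFields.BinaryQuadraticFormsPrimeRepresentation
import Mathlib.NumberTheory.SumTwoSquares
import HarnessLib

/-!
# The Hecke operator `T_p` on `H₁(X₀(N), ℤ)` as a transfer: `T_p{∞, γ∞} = ∑ᵢ {∞, γ'ᵢ∞}`

[topic NumberTheory/ModularSymbols]

For `p` prime let `Γ₀(N) diag(1,p) Γ₀(N) = ⊔_{i ∈ I_p(N)} Γ₀(N) βᵢ` be the standard coset decomposition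
(`βⱼ = (1 j; 0 p)`, `j mod p`, and `β_∞ = diag(p, 1)` when `p ∤ N`; the tree's `heckeRep`, `HeckeIdx`), and for
`γ ∈ Γ₀(N)` let `βᵢ γ = γ'ᵢ β_{σ(i)}` with `γ'ᵢ ∈ Γ₀(N)` and `σ = σ_γ` a permutation of `I_p(N)` (the tree's
`heckePermElt`, `heckePerm`; Shimura §8.3, `αᵢ γ = γᵢ α_{j}`).  This file proves:

* `T_smul_symbolInt_eq_sum` — **`T_p{∞, γ∞} = ∑_{i ∈ I_p(N)} {∞, γ'ᵢ ∞}`** in `Λ = H₁(X₀(N), ℤ)`, for every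
  prime `p` (Knapp, *Elliptic Curves*, (11.38) and Prop. 11.23: "`T(n)[γ] = ∑ᵢ [γᵢ]`", with (11.30)
  `αᵢ γ = γᵢ α_{j(i)}`, PDF p. 244; Shimura (8.3.2); Cremona (2.4.1)–(2.4.2) on closed paths).  The tree had the
  existential form `exists_T_smul_symbolInt` (`δⱼ, δ'` unnamed); here the summands are the explicit
  `heckePermElt`, so that the cocycle identities `σ_{γδ} = σ_δ ∘ σ_γ`, `(γδ)'ᵢ = γ'ᵢ δ'_{σ_γ i}`
  (`heckePerm_mul`, `heckePermElt_mul`) become available on homology.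
* `cuspSymbol_heckePermElt` — the cusp `γ'ᵢ ∞ = βᵢ(γ∞)` (`= (γ∞ + j)/p`, resp. `p · γ∞`).
* For `9 ∣ N`, `M = N/3` and the lifted symbols `Ψ(g) = {∞, (g∞)/3} ∈ Λ_N` of `g ∈ Γ₀(M)`
  (`liftedSymbol`, file `CuspidalHomologyPrymFixedPointSpan`):
  `T_smul_liftedSymbol_sub_sum_mem` — **`T_p Ψ(g) ≡ ∑_{l ∈ I_p(M)} Ψ(g'_l)` modulo `Λ₁ = (t_* − 1)Λ_N`**
  (`p ≠ 3`; exactly, `T_p Ψ(g) = ∑_l t_*^{k_l} Ψ(g'_l)` with `0 ≤ k_l ≤ 2`, because the level-`N`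
  representative `(1 j; 0 p)` acting on the cusp `(g∞)/3` is the level-`M` representative `(1 3j; 0 p)`
  up to a power of `T`), and the resulting homomorphism
  `liftedTraceModHom : Γ₀(M) → Λ_N/Λ₁`, `g ↦ ∑_l Ψ̄(g'_l) = T̄_p Ψ̄(g)`.
* `T_sub_two_smul_symbolInt_mem_shiftSubOneLattice_of` — the reduction of the fixed-point Hecke-shift
  statement at level `N` (`(T_p − 2){∞, γ∞} ∈ Λ₁` for `|3(a+d) − c| ≤ 6`) to the level-`M` statement
  `∑_l Ψ̄(e'_l) = 2 Ψ̄(e)` for `e ∈ Γ₀(M)` with `|tr e| ≤ 2`, via `diag(3,1) γ diag(3,1)⁻¹ = T e`.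

## References

* A. W. Knapp, *Elliptic Curves*, Math. Notes 40 (1993), §11.4 (11.30), (11.38), Prop. 11.23, (11.39a) (PDF pp. 243–245).
  [Knapp1993]
* G. Shimura, *Introduction to the arithmetic theory of automorphic functions* (1971), §8.3, p. 237, (8.3.2).
  [Shimura1971]
* J. E. Cremona, *Algorithms for modular elliptic curves*, 2nd ed. (1997), §2.4 (2.4.1)–(2.4.2). [CremonaAlgorithms1997]
* F. Diamond, J. Shurman, *A first course in modular forms* (2005), Prop. 5.2.1, Exercise 5.2.4. [DiamondShurman2005]
* Ju. I. Manin, *Parabolic points and zeta functions of modular curves* (1972), §1.5–1.7, Prop. 1.4. [Manin1972]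
-/

noncomputable section

open scoped MatrixGroups ModularForm

open CongruenceSubgroup UpperHalfPlane
open Literature.NumberTheory.EllipticCurves.ModularForms

namespace Literature.NumberTheory.ModularSymbols

/-! ### The cusps of the elements `γ'ᵢ` (`βᵢ γ = γ'ᵢ β_{σ(i)}`) -/

section Cusps

variable {N : ℕ} {p : ℕ} (hp : p.Prime)

/-- `βᵢ` is upper triangular: `(βᵢ)₁₀ = 0`. [cite: DiamondShurman2005, Prop. 5.2.1] -/
@[simp] theorem heckeRep_apply_one_zero (i : Option (ZMod p)) : heckeRep p i 1 0 = 0 := by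
  cases i <;> simp [heckeRep]

/-- `(βᵢ)₀₀ ≠ 0` (`= 1` or `= p`). [cite: DiamondShurman2005, Prop. 5.2.1] -/
theorem heckeRep_apply_zero_zero_ne_zero (hp0 : p ≠ 0) (i : Option (ZMod p)) : heckeRep p i 0 0 ≠ 0 := by
  cases i <;> simp [heckeRep, hp0]

/-- Product formula `βⱼ G = (a + j c, b + j d; p c, p d)`. [cite: DiamondShurman2005, Prop. 5.2.1] -/
theorem heckeRep_some_mul (j : ZMod p) (G : Matrix (Fin 2) (Fin 2) ℤ) :
    heckeRep p (some j) * G =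
      !![G 0 0 + (j.val : ℤ) * G 1 0, G 0 1 + (j.val : ℤ) * G 1 1; (p : ℤ) * G 1 0, (p : ℤ) * G 1 1] := by
  ext i k
  fin_cases i <;> fin_cases k <;> simp [heckeRep, Matrix.mul_apply, Fin.sum_univ_two]

/-- Product formula `β_∞ G = (p a, p b; c, d)`. [cite: DiamondShurman2005, Prop. 5.2.1] -/
theorem heckeRep_none_mul (G : Matrix (Fin 2) (Fin 2) ℤ) :
    heckeRep p none * G = !![(p : ℤ) * G 0 0, (p : ℤ) * G 0 1; G 1 0, G 1 1] := by
  ext i k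
  fin_cases i <;> fin_cases k <;> simp [heckeRep, Matrix.mul_apply, Fin.sum_univ_two]

include hp

/-- **First column of `γ'ᵢ`**: `(γ'ᵢ)_{k0} · (β_{σ i})₀₀ = (βᵢ γ)_{k0}` (from `γ'ᵢ β_{σ(i)} = βᵢ γ` and
`(β)₁₀ = 0`). [cite: Shimura1971, §8.3 p. 237] -/
theorem heckePermElt_apply_zero_mul (γ : Gamma0 N) (i : HeckeIdx N p) (k : Fin 2) :
    (heckePermElt hp γ i : SL(2, ℤ)) k 0 * heckeRep p (heckePerm hp γ i).1 0 0 =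
      (heckeRep p i.1 * ((γ : SL(2, ℤ)) : Matrix (Fin 2) (Fin 2) ℤ)) k 0 := by
  have h := congrFun (congrFun (heckePermElt_spec hp γ i) k) 0
  rw [Matrix.mul_apply, Fin.sum_univ_two, heckeRep_apply_one_zero, mul_zero, add_zero] at h
  exact h

/-- `(γ'ᵢ)₁₀ = 0 ↔ c = 0` (`γ = (a b; c d)`): `γ'ᵢ` fixes `∞` iff `γ` does. [cite: Shimura1971, §8.3 p. 237] -/
theorem heckePermElt_apply_one_zero_eq_zero_iff (γ : Gamma0 N) (i : HeckeIdx N p) :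
    (heckePermElt hp γ i : SL(2, ℤ)) 1 0 = 0 ↔ (γ : SL(2, ℤ)) 1 0 = 0 := by
  have h := heckePermElt_apply_zero_mul hp γ i 1
  have hβ := heckeRep_apply_zero_zero_ne_zero hp.ne_zero (heckePerm hp γ i).1
  have hp0 : (p : ℤ) ≠ 0 := by exact_mod_cast hp.ne_zero
  obtain ⟨_ | j, hi⟩ := i
  · rw [heckeRep_none_mul] at h
    simp only [Matrix.of_apply, Matrix.cons_val', Matrix.cons_val_zero, Matrix.cons_val_fin_one,
      Matrix.cons_val_one] at h
    constructor
    · intro h0; rw [h0, zero_mul] at h; exact h.symm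
    · intro h0; rw [h0] at h; exact (mul_eq_zero.mp h).resolve_right hβ
  · rw [heckeRep_some_mul] at h
    simp only [Matrix.of_apply, Matrix.cons_val', Matrix.cons_val_zero, Matrix.cons_val_fin_one,
      Matrix.cons_val_one] at h
    constructor
    · intro h0; rw [h0, zero_mul] at h; exact (mul_eq_zero.mp h.symm).resolve_left hp0
    · intro h0; rw [h0, mul_zero] at h; exact (mul_eq_zero.mp h).resolve_right hβ

/-- **The cusp of `γ'ᵢ` is `βᵢ(γ∞)`**: `γ'ᵢ∞ = (βᵢγ)₀₀/(βᵢγ)₁₀` when `c ≠ 0`. [cite: Shimura1971, §8.3 p. 237] -/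
theorem heckePermElt_cusp_eq (γ : Gamma0 N) (i : HeckeIdx N p) (hc : (γ : SL(2, ℤ)) 1 0 ≠ 0) :
    (((heckePermElt hp γ i : SL(2, ℤ)) 0 0 : ℤ) : ℚ) / ((heckePermElt hp γ i : SL(2, ℤ)) 1 0 : ℤ) =
      (((heckeRep p i.1 * ((γ : SL(2, ℤ)) : Matrix (Fin 2) (Fin 2) ℤ)) 0 0 : ℤ) : ℚ) /
        ((heckeRep p i.1 * ((γ : SL(2, ℤ)) : Matrix (Fin 2) (Fin 2) ℤ)) 1 0 : ℤ) := by
  have h0 := heckePermElt_apply_zero_mul hp γ i 0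
  have h1 := heckePermElt_apply_zero_mul hp γ i 1
  have hβ : ((heckeRep p (heckePerm hp γ i).1 0 0 : ℤ) : ℚ) ≠ 0 := by
    exact_mod_cast heckeRep_apply_zero_zero_ne_zero hp.ne_zero (heckePerm hp γ i).1
  have hc' : (((heckePermElt hp γ i : SL(2, ℤ)) 1 0 : ℤ) : ℚ) ≠ 0 := by
    exact_mod_cast fun h ↦ hc ((heckePermElt_apply_one_zero_eq_zero_iff hp γ i).mp h)
  rw [← h0, ← h1]
  push_cast
  rw [mul_div_mul_right _ _ hβ]

/-- **`{∞, γ'ⱼ∞}_f = {∞, (γ∞ + j)/p}_f`** for the representative `βⱼ = (1 j; 0 p)` (and `0` if `γ∞ = ∞`).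
[cite: CremonaAlgorithms1997, §2.4 (2.4.1)–(2.4.2)] -/
theorem cuspSymbol_heckePermElt_some (f : CuspForm (Gamma0 N) 2) (γ : Gamma0 N) (j : ZMod p)
    (hj : (some j : Option (ZMod p)) = none → ¬p ∣ N) :
    cuspSymbol f (heckePermElt hp γ ⟨some j, hj⟩) =
      if (γ : SL(2, ℤ)) 1 0 = 0 then 0
      else modularSymbol f (((((γ : SL(2, ℤ)) 0 0 : ℤ) : ℚ) / ((γ : SL(2, ℤ)) 1 0 : ℤ) + (j.val : ℤ)) / p) := by
  by_cases hc : (γ : SL(2, ℤ)) 1 0 = 0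
  · rw [if_pos hc, cuspSymbol, if_pos ((heckePermElt_apply_one_zero_eq_zero_iff hp γ _).mpr hc)]
  · rw [if_neg hc, cuspSymbol, if_neg (fun h ↦ hc ((heckePermElt_apply_one_zero_eq_zero_iff hp γ _).mp h)),
      heckePermElt_cusp_eq hp γ _ hc]
    congr 1
    simp only [heckeRep_some_mul, Matrix.of_apply, Matrix.cons_val', Matrix.cons_val_zero,
      Matrix.cons_val_fin_one, Matrix.cons_val_one]
    have hcq : (((γ : SL(2, ℤ)) 1 0 : ℤ) : ℚ) ≠ 0 := by exact_mod_cast hc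
    have hpq : ((p : ℤ) : ℚ) ≠ 0 := by exact_mod_cast hp.ne_zero
    push_cast
    field_simp

/-- **`{∞, γ'_∞ ∞}_f = {∞, p · γ∞}_f`** for the representative `β_∞ = diag(p, 1)` (and `0` if `γ∞ = ∞`).
[cite: CremonaAlgorithms1997, §2.4 (2.4.1)–(2.4.2)] -/
theorem cuspSymbol_heckePermElt_none (f : CuspForm (Gamma0 N) 2) (γ : Gamma0 N)
    (hn : (none : Option (ZMod p)) = none → ¬p ∣ N) :
    cuspSymbol f (heckePermElt hp γ ⟨none, hn⟩) =
      if (γ : SL(2, ℤ)) 1 0 = 0 then 0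
      else modularSymbol f (p * ((((γ : SL(2, ℤ)) 0 0 : ℤ) : ℚ) / ((γ : SL(2, ℤ)) 1 0 : ℤ))) := by
  by_cases hc : (γ : SL(2, ℤ)) 1 0 = 0
  · rw [if_pos hc, cuspSymbol, if_pos ((heckePermElt_apply_one_zero_eq_zero_iff hp γ _).mpr hc)]
  · rw [if_neg hc, cuspSymbol, if_neg (fun h ↦ hc ((heckePermElt_apply_one_zero_eq_zero_iff hp γ _).mp h)),
      heckePermElt_cusp_eq hp γ _ hc]
    congr 1
    simp only [heckeRep_none_mul, Matrix.of_apply, Matrix.cons_val', Matrix.cons_val_zero,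
      Matrix.cons_val_fin_one, Matrix.cons_val_one]
    have hcq : (((γ : SL(2, ℤ)) 1 0 : ℤ) : ℚ) ≠ 0 := by exact_mod_cast hc
    push_cast
    field_simp

end Cusps

/-! ### `T_p{∞, γ∞} = ∑ᵢ {∞, γ'ᵢ∞}` -/

section Transfer

variable (N : ℕ) [NeZero N] {p : ℕ} [NeZero p] (hp : p.Prime)
include hp

/-- **`T_p` on `H₁(X₀(N), ℤ)` is the transfer along the Hecke cosets** (Knapp (11.38), Prop. 11.23;
Shimura (8.3.2); Cremona (2.4.1)–(2.4.2)): for `γ ∈ Γ₀(N)` and `p` prime,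
`T_p{∞, γ∞} = ∑_{i ∈ I_p(N)} {∞, γ'ᵢ∞}` where `βᵢ γ = γ'ᵢ β_{σ(i)}`.  Proof: pair with `f ∈ S₂(Γ₀(N))`;
`{∞, γ∞}_{T_p f} = ∑ⱼ {∞, (γ∞ + j)/p}_f + 𝟙_{p ∤ N}{∞, p·γ∞}_f` (`modularSymbol_heckeT_eq_sum`) and
`γ'ᵢ∞ = βᵢ(γ∞)` (`cuspSymbol_heckePermElt_some/none`). [cite: Knapp1993, (11.38), Prop. 11.23 and (11.39a) (PDF p. 244)]
[cite: Shimura1971, §8.3 p. 237 (8.3.2)] -/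
theorem T_smul_symbolInt_eq_sum (γ : Gamma0 N) :
    HeckeRing0.T N 2 p hp • symbolInt N γ = ∑ i : HeckeIdx N p, symbolInt N (heckePermElt hp γ i) := by
  apply Subtype.ext
  rw [AddSubmonoidClass.coe_finsetSum]
  ext f
  have h1 : ((HeckeRing0.T N 2 p hp • symbolInt N γ : periodHomologyHecke N) :
      Module.Dual ℂ (CuspForm (Gamma0 N) 2)) f = cuspSymbol (heckeT (Gamma0 N) 2 p f) γ :=
    rfl
  rw [h1, LinearMap.sum_apply]
  simp only [symbolInt_apply]
  -- the summands as a function on `Option (ZMod p)`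
  set F : Option (ZMod p) → ℂ := fun i ↦
    match i with
    | some j => if (γ : SL(2, ℤ)) 1 0 = 0 then 0
        else modularSymbol f (((((γ : SL(2, ℤ)) 0 0 : ℤ) : ℚ) / ((γ : SL(2, ℤ)) 1 0 : ℤ) + (j.val : ℤ)) / p)
    | none => if (γ : SL(2, ℤ)) 1 0 = 0 then 0
        else modularSymbol f (p * ((((γ : SL(2, ℤ)) 0 0 : ℤ) : ℚ) / ((γ : SL(2, ℤ)) 1 0 : ℤ))) with hF
  have hsum : ∑ i : HeckeIdx N p, cuspSymbol f (heckePermElt hp γ i) = ∑ i : HeckeIdx N p, F i.1 := by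
    refine Finset.sum_congr rfl fun i _ ↦ ?_
    obtain ⟨_ | j, hi⟩ := i
    · exact cuspSymbol_heckePermElt_none hp f γ hi
    · exact cuspSymbol_heckePermElt_some hp f γ j hi
  rw [hsum, sum_heckeIdx N p F]
  by_cases hc : (γ : SL(2, ℤ)) 1 0 = 0
  · rw [cuspSymbol, if_pos hc]
    simp [hF, hc]
  · rw [cuspSymbol, if_neg hc, modularSymbol_heckeT_eq_sum p f hp]
    simp only [hF, if_neg hc]
    congr 1
    exact (sum_zmod_val_eq_sum_fin p (fun n ↦ modularSymbol f
      (((((γ : SL(2, ℤ)) 0 0 : ℤ) : ℚ) / ((γ : SL(2, ℤ)) 1 0 : ℤ) + (n : ℤ)) / p))).symm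

end Transfer

/-! ### Level `M = N/3`: `T_p` on the lifted symbols `Ψ(g) = {∞, (g∞)/3}`, `g ∈ Γ₀(M)` -/

section Shift

variable (N : ℕ) [NeZero N] (h9 : 3 ^ 2 ∣ N)

/-- `(t_*ᵏ x)(f) = x(f ∣ tᵏ)`. [cite: Harrison2011X0108, §2] -/
theorem coe_shiftInt_pow_apply (k : ℕ) (x : periodHomologyHecke N) (f : CuspForm (Gamma0 N) 2) :
    ((shiftInt N h9 ^ k) x : Module.Dual ℂ (CuspForm (Gamma0 N) 2)) f =
      (x : Module.Dual ℂ (CuspForm (Gamma0 N) 2)) ((shiftCuspForm N h9)^[k] f) := by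
  induction k generalizing x with
  | zero => simp
  | succ k ih =>
    rw [pow_succ, Module.End.mul_apply, ih, coe_shiftInt_apply, Function.iterate_succ_apply']

/-- **`{∞, r}_{f∣tᵏ} = {∞, r + k/3}_f`.** [cite: Manin1972, §1.5 and Prop. 1.4] -/
theorem modularSymbol_shiftCuspForm_iterate (k : ℕ) (f : CuspForm (Gamma0 N) 2) (r : ℚ) :
    modularSymbol ((shiftCuspForm N h9)^[k] f) r = modularSymbol f (r + k / 3) := by
  induction k generalizing r with
  | zero => simp
  | succ k ih =>
    rw [Function.iterate_succ_apply', modularSymbol_shiftCuspForm, ih]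
    congr 1
    push_cast
    ring

/-- **`Ψ(g)(f) = {∞, a/(3c)}_f`** for `g = (a b; c d) ∈ Γ₀(N/3)` (and `0` if `c = 0`). [cite: Manin1972, §1.5 and Prop. 1.4] -/
theorem coe_liftedSymbol_apply (g : Gamma0 (N / 3)) (f : CuspForm (Gamma0 N) 2) :
    (liftedSymbol N h9 g : Module.Dual ℂ (CuspForm (Gamma0 N) 2)) f =
      if (g : SL(2, ℤ)) 1 0 = 0 then 0
      else modularSymbol f ((((g : SL(2, ℤ)) 0 0 : ℤ) : ℚ) / (3 * (((g : SL(2, ℤ)) 1 0 : ℤ) : ℚ))) := by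
  unfold liftedSymbol
  rw [symbolInt_apply, cuspSymbol, Gamma0.mkOfCol_apply_zero_zero, Gamma0.mkOfCol_apply_one_zero]
  simp only [mul_eq_zero, OfNat.ofNat_ne_zero, false_or, Int.cast_mul, Int.cast_ofNat]

end Shift

section LiftedTransfer

variable (N : ℕ) [NeZero N] (h9 : 3 ^ 2 ∣ N) {p : ℕ} [NeZero p] (hp : p.Prime) (hp3 : p ≠ 3)

/-- `3 ∣ N` (from `9 ∣ N`) (plumbing). [folklore] -/
private theorem three_dvd' {L : ℕ} (h9' : 3 ^ 2 ∣ L) : 3 ∣ L := (dvd_pow_self 3 two_ne_zero).trans h9'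

/-- For `q ≠ 3` prime: `q ∣ L ↔ q ∣ L/3` (`9 ∣ L`) (plumbing). [folklore] -/
private theorem dvd_iff_dvd_div_three {L q : ℕ} (h9' : 3 ^ 2 ∣ L) (hq : q.Prime) (hq3 : q ≠ 3) :
    q ∣ L ↔ q ∣ L / 3 := by
  constructor
  · intro h
    rw [← Nat.div_mul_cancel (three_dvd' h9')] at h
    rcases hq.dvd_mul.mp h with h' | h'
    · exact h'
    · exact absurd ((Nat.prime_dvd_prime_iff_eq hq Nat.prime_three).mp h') hq3
  · exact fun h ↦ h.trans (Nat.div_dvd_of_dvd (three_dvd' h9'))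

/-- `3` is prime to `q ≠ 3` prime (plumbing). [folklore] -/
private theorem coprime_three {q : ℕ} (hq : q.Prime) (hq3 : q ≠ 3) : Nat.Coprime 3 q :=
  (Nat.coprime_primes Nat.prime_three hq).mpr (Ne.symm hq3)

/-- **The index map `I_p(N) → I_p(N/3)`, `j ↦ 3j`, `∞ ↦ ∞`** (`p ≠ 3`, `9 ∣ N`): the level-`N`
representative `βⱼ = (1 j; 0 p)` moves the cusp `(g∞)/3` to `((1 3j; 0 p) g∞)/3`, and `p ∤ N ↔ p ∤ N/3`.
[cite: DiamondShurman2005, Prop. 5.2.1 and Exercise 5.2.4] -/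
def heckeIdxThree : HeckeIdx N p ≃ HeckeIdx (N / 3) p :=
  (Equiv.optionCongr (ZMod.unitOfCoprime 3 (coprime_three hp hp3)).mulLeft).subtypeEquiv fun i ↦ by
    rw [Equiv.optionCongr_apply, Option.map_eq_none_iff, dvd_iff_dvd_div_three h9 hp hp3]

omit [NeZero N] [NeZero p] in
/-- `heckeIdxThree` on `j mod p` is `3j mod p`. [cite: DiamondShurman2005, Prop. 5.2.1 and Exercise 5.2.4] -/
@[simp] theorem heckeIdxThree_some (j : ZMod p) (hj : (some j : Option (ZMod p)) = none → ¬p ∣ N) :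
    (heckeIdxThree N h9 hp hp3 ⟨some j, hj⟩ : HeckeIdx (N / 3) p).1 = some (3 * j) := by
  simp [heckeIdxThree, Equiv.subtypeEquiv_apply, Units.mulLeft_apply]

omit [NeZero N] [NeZero p] in
/-- `heckeIdxThree ∞ = ∞`. [cite: DiamondShurman2005, Prop. 5.2.1 and Exercise 5.2.4] -/
@[simp] theorem heckeIdxThree_none (hn : (none : Option (ZMod p)) = none → ¬p ∣ N) :
    (heckeIdxThree N h9 hp hp3 ⟨none, hn⟩ : HeckeIdx (N / 3) p).1 = none := by
  simp [heckeIdxThree, Equiv.subtypeEquiv_apply]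

/-- **The shift exponent `k_j = ⌊3j/p⌋ ∈ {0, 1, 2}`** (`0 ≤ j < p` the lift of `j mod p`; `k_∞ = 0`):
`(1 j; 0 p)` applied to the cusp `r/3` gives `((1 3j; 0 p) r)/3 = ((1 j'; 0 p) r)/3 + k_j/3` with
`j' = 3j − k_j p` the lift of `3j mod p`. [cite: Manin1972, §1.5 and Prop. 1.4] -/
def heckeShiftExp (i : HeckeIdx N p) : ℕ :=
  i.1.elim 0 fun j ↦ 3 * j.val / p

omit [NeZero p] in
/-- `(3j mod p) + p · ⌊3j/p⌋ = 3j` for the lifts (plumbing). [folklore] -/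
private theorem val_three_mul_add (j : ZMod p) :
    ((3 * j : ZMod p)).val + p * (3 * j.val / p) = 3 * j.val := by
  have h1 : ((3 * j : ZMod p)).val = 3 * j.val % p := by
    rw [ZMod.val_mul]
    have : ((3 : ZMod p)).val = 3 % p := by
      rw [← Nat.cast_ofNat, ZMod.val_natCast]
    rw [this, Nat.mod_mul_mod]
  rw [h1]
  exact Nat.mod_add_div (3 * j.val) p

/-- The element `γ_g ∈ Γ₀(N)` with first column `(a, 3c)` whose symbol is `Ψ(g)` (`liftedSymbol g = {∞, γ_g∞}`).
[cite: Manin1972, §1.5 and Prop. 1.4] -/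
def liftCol (g : Gamma0 (N / 3)) : Gamma0 N :=
  Gamma0.mkOfCol ((g : SL(2, ℤ)) 0 0) (3 * (g : SL(2, ℤ)) 1 0)
    (isCoprime_apply_three_mul N h9 g) (natCast_dvd_three_mul N h9 g)

/-- `Ψ(g) = {∞, γ_g ∞}`. [cite: Manin1972, §1.5 and Prop. 1.4] -/
theorem liftedSymbol_eq_symbolInt_liftCol (g : Gamma0 (N / 3)) :
    liftedSymbol N h9 g = symbolInt N (liftCol N h9 g) :=
  rfl

omit [NeZero N] in
/-- `(γ_g)₀₀ = a`. [cite: Manin1972, §1.5 and Prop. 1.4] -/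
@[simp] theorem liftCol_apply_zero_zero (g : Gamma0 (N / 3)) :
    (liftCol N h9 g : SL(2, ℤ)) 0 0 = (g : SL(2, ℤ)) 0 0 :=
  Gamma0.mkOfCol_apply_zero_zero _ _ _ _

omit [NeZero N] in
/-- `(γ_g)₁₀ = 3c`. [cite: Manin1972, §1.5 and Prop. 1.4] -/
@[simp] theorem liftCol_apply_one_zero (g : Gamma0 (N / 3)) :
    (liftCol N h9 g : SL(2, ℤ)) 1 0 = 3 * (g : SL(2, ℤ)) 1 0 :=
  Gamma0.mkOfCol_apply_one_zero _ _ _ _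

omit [NeZero p] in
include hp3 in
/-- **The level-`N` summand `{∞, (γ_g)'ᵢ∞}` is `t_*^{kᵢ} Ψ(g'_{ι i})`** (`ι = heckeIdxThree`, `kᵢ = heckeShiftExp`):
for `i = j mod p`, `(γ_g)'ⱼ∞ = (a/(3c) + j)/p = ((a/c + j')/p)/3 + k_j/3` with `j' + k_j p = 3j`, and
`((a/c + j')/p)/3 = (g'_{3j}∞)/3`; for `i = ∞`, `p·a/(3c) = (p·a/c)/3`. [cite: Manin1972, §1.5–1.7 and Prop. 1.4] -/
theorem symbolInt_heckePermElt_liftCol (g : Gamma0 (N / 3)) (i : HeckeIdx N p) :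
    symbolInt N (heckePermElt hp (liftCol N h9 g) i) =
      (shiftInt N h9 ^ heckeShiftExp N i)
        (liftedSymbol N h9 (heckePermElt hp g (heckeIdxThree N h9 hp hp3 i))) := by
  apply Subtype.ext
  ext f
  rw [symbolInt_apply, coe_shiftInt_pow_apply, coe_liftedSymbol_apply, modularSymbol_shiftCuspForm_iterate]
  by_cases hc : (g : SL(2, ℤ)) 1 0 = 0
  · have hc' : (liftCol N h9 g : SL(2, ℤ)) 1 0 = 0 := by simp [hc]
    rw [if_pos ((heckePermElt_apply_one_zero_eq_zero_iff hp g _).mpr hc), cuspSymbol,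
      if_pos ((heckePermElt_apply_one_zero_eq_zero_iff hp _ i).mpr hc')]
  · have hc' : (liftCol N h9 g : SL(2, ℤ)) 1 0 ≠ 0 := by simpa using hc
    have hcq : (((g : SL(2, ℤ)) 1 0 : ℤ) : ℚ) ≠ 0 := by exact_mod_cast hc
    have hpq : ((p : ℤ) : ℚ) ≠ 0 := by exact_mod_cast hp.ne_zero
    have hpq' : (p : ℚ) ≠ 0 := by exact_mod_cast hp.ne_zero
    rw [if_neg (fun h ↦ hc ((heckePermElt_apply_one_zero_eq_zero_iff hp g _).mp h)), mul_comm (3 : ℚ),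
      ← div_div, heckePermElt_cusp_eq hp g _ hc]
    obtain ⟨_ | j, hi⟩ := i
    · rw [cuspSymbol_heckePermElt_none hp f _ hi, if_neg hc', heckeIdxThree_none]
      simp only [heckeRep_none_mul, Matrix.of_apply, Matrix.cons_val', Matrix.cons_val_zero,
        Matrix.cons_val_fin_one, Matrix.cons_val_one, liftCol_apply_zero_zero, liftCol_apply_one_zero,
        heckeShiftExp, Option.elim, Nat.cast_zero, zero_div, add_zero]
      congr 1
      push_cast
      field_simp
    · rw [cuspSymbol_heckePermElt_some hp f _ j hi, if_neg hc', heckeIdxThree_some]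
      simp only [heckeRep_some_mul, Matrix.of_apply, Matrix.cons_val', Matrix.cons_val_zero,
        Matrix.cons_val_fin_one, Matrix.cons_val_one, liftCol_apply_zero_zero, liftCol_apply_one_zero,
        heckeShiftExp, Option.elim]
      congr 1
      have hk := val_three_mul_add j
      have hkq : (((3 * j : ZMod p)).val : ℚ) = 3 * (j.val : ℚ) - (p : ℚ) * ((3 * j.val / p : ℕ) : ℚ) := by
        have h' : (((3 * j : ZMod p)).val : ℚ) + (p : ℚ) * ((3 * j.val / p : ℕ) : ℚ) = 3 * (j.val : ℚ) := by
          exact_mod_cast hk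
        linarith
      push_cast
      rw [hkq]
      field_simp
      ring

include hp3 in
/-- **`T_p Ψ(g) = ∑_{i ∈ I_p(N)} t_*^{kᵢ} Ψ(g'_{ι(i)})`** (exact form of the transfer on lifted symbols).
[cite: Knapp1993, (11.38), Prop. 11.23 and (11.39a) (PDF p. 244)] -/
theorem T_smul_liftedSymbol_eq_sum (g : Gamma0 (N / 3)) :
    HeckeRing0.T N 2 p hp • liftedSymbol N h9 g =
      ∑ i : HeckeIdx N p, (shiftInt N h9 ^ heckeShiftExp N i)
        (liftedSymbol N h9 (heckePermElt hp g (heckeIdxThree N h9 hp hp3 i))) := by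
  rw [liftedSymbol_eq_symbolInt_liftCol, T_smul_symbolInt_eq_sum N hp]
  exact Finset.sum_congr rfl fun i _ ↦ symbolInt_heckePermElt_liftCol N h9 hp hp3 g i

include hp3 in
/-- **`T_p Ψ(g) ≡ ∑_{l ∈ I_p(N/3)} Ψ(g'_l) (mod Λ₁)`**, `Λ₁ = (t_* − 1)Λ_N`: the transfer formula for the
lifted symbols holds modulo the shift (`t_*^k y − y ∈ Λ₁`). [cite: Knapp1993, (11.38), Prop. 11.23 and (11.39a) (PDF p. 244)] -/
theorem T_smul_liftedSymbol_sub_sum_mem (g : Gamma0 (N / 3)) :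
    HeckeRing0.T N 2 p hp • liftedSymbol N h9 g -
        ∑ l : HeckeIdx (N / 3) p, liftedSymbol N h9 (heckePermElt hp g l) ∈ shiftSubOneLattice N h9 := by
  rw [T_smul_liftedSymbol_eq_sum N h9 hp hp3,
    ← Equiv.sum_comp (heckeIdxThree N h9 hp hp3) (fun l ↦ liftedSymbol N h9 (heckePermElt hp g l)),
    ← Finset.sum_sub_distrib]
  exact Submodule.sum_mem _ fun i _ ↦ shiftInt_pow_sub_mem_shiftSubOneLattice N h9 _ _

end LiftedTransfer

/-! ### The trace `τ(g) = ∑_l Ψ̄(g'_l)` and the reduction of the fixed-point Hecke shift to level `N/3` -/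

section Trace

variable (N : ℕ) [NeZero N] (h9 : 3 ^ 2 ∣ N) {p : ℕ} [NeZero p] (hp : p.Prime)

/-- `Ψ(g) = 0` if `g` fixes `∞` (`c = 0`). [cite: Manin1972, §1.5 and Prop. 1.4] -/
theorem liftedSymbol_eq_zero_of_apply_one_zero {g : Gamma0 (N / 3)} (hg : (g : SL(2, ℤ)) 1 0 = 0) :
    liftedSymbol N h9 g = 0 := by
  apply Subtype.ext
  ext f
  rw [coe_liftedSymbol_apply, if_pos hg]
  rfl

/-- **Additivity of the trace modulo `Λ₁`**: `∑_l Ψ((gg')'_l) ≡ ∑_l Ψ(g'_l) + ∑_l Ψ(g''_l)`, from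
`(gg')'_l = g'_l g''_{σ_g l}` (`heckePermElt_mul`), `Ψ(xy) ≡ Ψ(x) + Ψ(y)` and the bijectivity of `σ_g`.
[cite: Shimura1971, §8.3 p. 237] -/
theorem sum_liftedSymbol_heckePermElt_mul_sub_mem (g g' : Gamma0 (N / 3)) :
    ∑ l : HeckeIdx (N / 3) p, liftedSymbol N h9 (heckePermElt hp (g * g') l) -
        ∑ l : HeckeIdx (N / 3) p, liftedSymbol N h9 (heckePermElt hp g l) -
        ∑ l : HeckeIdx (N / 3) p, liftedSymbol N h9 (heckePermElt hp g' l) ∈ shiftSubOneLattice N h9 := by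
  rw [← Equiv.sum_comp (heckePermEquiv hp g) (fun l ↦ liftedSymbol N h9 (heckePermElt hp g' l)),
    ← Finset.sum_sub_distrib, ← Finset.sum_sub_distrib]
  refine Submodule.sum_mem _ fun l _ ↦ ?_
  rw [HidaCohomology.heckePermElt_mul hp g g' l, heckePermEquiv_apply]
  exact liftedSymbol_mul_sub_sub_mem N h9 _ _

/-- The trace of an element fixing `∞` vanishes: `∑_l Ψ(g'_l) = 0` if `c = 0` (each `g'_l` fixes `∞`).
[cite: Shimura1971, §8.3 p. 237] -/
theorem sum_liftedSymbol_heckePermElt_eq_zero_of_apply_one_zero {g : Gamma0 (N / 3)}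
    (hg : (g : SL(2, ℤ)) 1 0 = 0) :
    ∑ l : HeckeIdx (N / 3) p, liftedSymbol N h9 (heckePermElt hp g l) = 0 :=
  Finset.sum_eq_zero fun l _ ↦
    liftedSymbol_eq_zero_of_apply_one_zero N h9 ((heckePermElt_apply_one_zero_eq_zero_iff hp g l).mpr hg)

/-- **The trace homomorphism `τ : Γ₀(N/3) → Λ_N/Λ₁`, `g ↦ ∑_{l ∈ I_p(N/3)} Ψ̄(g'_l)`** (written
multiplicatively); for `p ≠ 3` it is `T̄_p ∘ Ψ̄` (`liftedTraceModHom_eq`). [cite: Knapp1993, (11.38), Prop. 11.23 and (11.39a) (PDF p. 244)] -/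
def liftedTraceModHom : Gamma0 (N / 3) →* Multiplicative (periodHomologyHecke N ⧸ shiftSubOneLattice N h9) where
  toFun g := Multiplicative.ofAdd ((shiftSubOneLattice N h9).mkQ
    (∑ l : HeckeIdx (N / 3) p, liftedSymbol N h9 (heckePermElt hp g l)))
  map_one' := by
    rw [sum_liftedSymbol_heckePermElt_eq_zero_of_apply_one_zero N h9 hp (by simp), map_zero, ofAdd_zero]
  map_mul' g g' := by
    rw [← ofAdd_add, ← map_add]
    congr 1
    refine (Submodule.Quotient.eq _).mpr ?_
    have := sum_liftedSymbol_heckePermElt_mul_sub_mem N h9 hp g g'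
    rwa [sub_sub] at this

/-- Unfolding `liftedTraceModHom`. [cite: Knapp1993, (11.38), Prop. 11.23 and (11.39a) (PDF p. 244)] -/
theorem liftedTraceModHom_apply (g : Gamma0 (N / 3)) :
    liftedTraceModHom N h9 hp g = Multiplicative.ofAdd ((shiftSubOneLattice N h9).mkQ
      (∑ l : HeckeIdx (N / 3) p, liftedSymbol N h9 (heckePermElt hp g l))) :=
  rfl

/-- **`τ = T̄_p ∘ Ψ̄`** (`p ≠ 3`): `∑_l Ψ̄(g'_l) = [T_p Ψ(g)]` in `Λ_N/Λ₁`. [cite: Knapp1993, (11.38), Prop. 11.23 and (11.39a) (PDF p. 244)] -/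
theorem liftedTraceModHom_eq (hp3 : p ≠ 3) (g : Gamma0 (N / 3)) :
    liftedTraceModHom N h9 hp g =
      Multiplicative.ofAdd ((shiftSubOneLattice N h9).mkQ (HeckeRing0.T N 2 p hp • liftedSymbol N h9 g)) := by
  rw [liftedTraceModHom_apply]
  congr 1
  exact ((Submodule.Quotient.eq _).mpr (T_smul_liftedSymbol_sub_sum_mem N h9 hp hp3 g)).symm

/-- **The trace is a class function**: `τ(x g x⁻¹) = τ(g)`. [cite: Shimura1971, §8.3 p. 237] -/
theorem liftedTraceModHom_conj (x g : Gamma0 (N / 3)) :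
    liftedTraceModHom N h9 hp (x * g * x⁻¹) = liftedTraceModHom N h9 hp g := by
  rw [map_mul, map_mul, map_inv, mul_inv_cancel_comm]

omit [NeZero N] in
/-- `3 · tr(T⁻¹ · DγD⁻¹) = 3(a + d) − c` for `γ = (a b; c d) ∈ Γ₀(N)`, `D = diag(3,1)`: writing
`DγD⁻¹ = T e`, `tr e = a + d − c/3` (plumbing for the reduction). [cite: Shimura1971, §1.3] -/
theorem three_mul_trace_gamma0T_inv_mul_degeneracyConj (γ : Gamma0 N) :
    3 * ((((gamma0T (N / 3))⁻¹ * Gamma0.degeneracyConj (N / 3) N 3 (div_three_mul_three_dvd' h9) γ :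
        Gamma0 (N / 3)) : SL(2, ℤ)) 0 0 +
      (((gamma0T (N / 3))⁻¹ * Gamma0.degeneracyConj (N / 3) N 3 (div_three_mul_three_dvd' h9) γ :
        Gamma0 (N / 3)) : SL(2, ℤ)) 1 1) =
      3 * ((γ : SL(2, ℤ)) 0 0 + (γ : SL(2, ℤ)) 1 1) - (γ : SL(2, ℤ)) 1 0 := by
  set e : Gamma0 (N / 3) := (gamma0T (N / 3))⁻¹ *
    Gamma0.degeneracyConj (N / 3) N 3 (div_three_mul_three_dvd' h9) γ with he
  have hTe : gamma0T (N / 3) * e = Gamma0.degeneracyConj (N / 3) N 3 (div_three_mul_three_dvd' h9) γ := by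
    rw [he, mul_inv_cancel_left]
  obtain ⟨h00, -, h10, h11⟩ := gamma0T_mul_apply (N / 3) e
  rw [hTe] at h00 h10 h11
  simp only [Gamma0.degeneracyConj_apply, Gamma0.degeneracyConjElt_apply_zero_zero,
    Gamma0.degeneracyConjElt_apply_one_zero, Gamma0.degeneracyConjElt_apply_one_one, Nat.cast_ofNat] at h00 h10 h11
  have h3 : (3 : ℤ) ∣ (γ : SL(2, ℤ)) 1 0 :=
    (show (3 : ℤ) ∣ (3 : ℤ) ^ 2 from ⟨3, by norm_num⟩).trans (sq_dvd_entry_of_mem_Gamma0 (m := 3) h9 γ.2)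
  have hc : (γ : SL(2, ℤ)) 1 0 = 3 * (e : SL(2, ℤ)) 1 0 := by
    rw [← h10]; exact (Int.mul_ediv_cancel' h3).symm
  linear_combination -3 * h00 - 3 * h11 + hc

include hp in
/-- **Reduction of the fixed-point Hecke shift to level `N/3`.**  Suppose that for every `e ∈ Γ₀(N/3)` with
`|tr e| ≤ 2` (parabolic, elliptic or `±1`) the trace satisfies `∑_{l ∈ I_p(N/3)} Ψ(e'_l) ≡ 2Ψ(e) (mod Λ₁)`.
Then for every `γ = (a b; c d) ∈ Γ₀(N)` with `|3(a+d) − c| ≤ 6`, `(T_p − 2){∞, γ∞} ∈ Λ₁ = (t_* − 1)Λ_N`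
(`p ≠ 3` prime).  Proof: `DγD⁻¹ = T e` with `3 tr e = 3(a+d) − c`, `{∞, γ∞} = Ψ(Te) ≡ Ψ(e)`,
`T_p Ψ(Te) ≡ τ(Te) = τ(T) + τ(e) = τ(e)` (`T'_l` fixes `∞`), and `τ(e) ≡ 2Ψ(e)` by hypothesis.
[cite: Knapp1993, (11.38), Prop. 11.23 and (11.39a) (PDF p. 244)] [cite: Manin1972, §1.5–1.7] -/
theorem T_sub_two_smul_symbolInt_mem_shiftSubOneLattice_of (hp3 : p ≠ 3)
    (H : ∀ e : Gamma0 (N / 3), |(e : SL(2, ℤ)) 0 0 + (e : SL(2, ℤ)) 1 1| ≤ 2 →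
      ∑ l : HeckeIdx (N / 3) p, liftedSymbol N h9 (heckePermElt hp e l) - 2 • liftedSymbol N h9 e ∈
        shiftSubOneLattice N h9)
    (γ : Gamma0 N)
    (hγ : |3 * ((γ : SL(2, ℤ)) 0 0 + (γ : SL(2, ℤ)) 1 1) - (γ : SL(2, ℤ)) 1 0| ≤ 6) :
    (HeckeRing0.T N 2 p hp - 2) • symbolInt N γ ∈ shiftSubOneLattice N h9 := by
  set e : Gamma0 (N / 3) := (gamma0T (N / 3))⁻¹ *
    Gamma0.degeneracyConj (N / 3) N 3 (div_three_mul_three_dvd' h9) γ with he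
  have hTe : gamma0T (N / 3) * e = Gamma0.degeneracyConj (N / 3) N 3 (div_three_mul_three_dvd' h9) γ := by
    rw [he, mul_inv_cancel_left]
  have htr : |(e : SL(2, ℤ)) 0 0 + (e : SL(2, ℤ)) 1 1| ≤ 2 := by
    have h3 := three_mul_trace_gamma0T_inv_mul_degeneracyConj N h9 γ
    rw [← he] at h3
    have : 3 * |(e : SL(2, ℤ)) 0 0 + (e : SL(2, ℤ)) 1 1| ≤ 6 := by
      rw [show (3 : ℤ) * |(e : SL(2, ℤ)) 0 0 + (e : SL(2, ℤ)) 1 1| =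
        |3 * ((e : SL(2, ℤ)) 0 0 + (e : SL(2, ℤ)) 1 1)| by rw [abs_mul]; norm_num, h3]
      exact hγ
    omega
  have hγe : symbolInt N γ = shiftInt N h9 (liftedSymbol N h9 e) := by
    rw [← liftedSymbol_degeneracyConj N h9 γ, ← hTe, liftedSymbol_gamma0T_mul]
  -- the four congruences
  have hA := T_smul_liftedSymbol_sub_sum_mem N h9 hp hp3 (gamma0T (N / 3) * e)
  have hB : ∑ l : HeckeIdx (N / 3) p, liftedSymbol N h9 (heckePermElt hp (gamma0T (N / 3) * e) l) -
      ∑ l : HeckeIdx (N / 3) p, liftedSymbol N h9 (heckePermElt hp e l) ∈ shiftSubOneLattice N h9 := by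
    have h := sum_liftedSymbol_heckePermElt_mul_sub_mem N h9 hp (gamma0T (N / 3)) e
    rwa [sum_liftedSymbol_heckePermElt_eq_zero_of_apply_one_zero N h9 hp
      (g := gamma0T (N / 3)) (by simp [ModularGroup.T]), sub_zero] at h
  have hC := H e htr
  have hD : (2 : ℕ) • (shiftInt N h9 (liftedSymbol N h9 e) - liftedSymbol N h9 e) ∈
      shiftSubOneLattice N h9 := by
    refine Submodule.smul_of_tower_mem _ 2 ?_
    simpa using shiftInt_pow_sub_mem_shiftSubOneLattice N h9 1 (liftedSymbol N h9 e)
  have hT : HeckeRing0.T N 2 p hp • symbolInt N γ =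
      HeckeRing0.T N 2 p hp • liftedSymbol N h9 (gamma0T (N / 3) * e) := by
    rw [hγe, liftedSymbol_gamma0T_mul]
  have key : (HeckeRing0.T N 2 p hp - 2) • symbolInt N γ =
      (HeckeRing0.T N 2 p hp • liftedSymbol N h9 (gamma0T (N / 3) * e) -
          ∑ l : HeckeIdx (N / 3) p, liftedSymbol N h9 (heckePermElt hp (gamma0T (N / 3) * e) l)) +
        (∑ l : HeckeIdx (N / 3) p, liftedSymbol N h9 (heckePermElt hp (gamma0T (N / 3) * e) l) -
          ∑ l : HeckeIdx (N / 3) p, liftedSymbol N h9 (heckePermElt hp e l)) +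
        (∑ l : HeckeIdx (N / 3) p, liftedSymbol N h9 (heckePermElt hp e l) - 2 • liftedSymbol N h9 e) -
        (2 : ℕ) • (shiftInt N h9 (liftedSymbol N h9 e) - liftedSymbol N h9 e) := by
    rw [show (HeckeRing0.T N 2 p hp - 2) • symbolInt N γ =
        HeckeRing0.T N 2 p hp • symbolInt N γ - (2 : HeckeRing0 N 2) • symbolInt N γ from
        sub_smul (HeckeRing0.T N 2 p hp) (2 : HeckeRing0 N 2) (symbolInt N γ),
      ofNat_smul_eq_nsmul, hT, ← hγe]
    simp only [two_smul, smul_sub]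
    abel
  rw [key]
  exact Submodule.sub_mem _ (Submodule.add_mem _ (Submodule.add_mem _ hA hB) hC) hD

end Trace

/-! ### Orbits of `σ_g` on `I_p(N/3)` for `g` of finite order modulo `±1` (elliptic elements) -/

section PermOrbits

/-- **Orbit decomposition for a permutation of prime order.**  If `σ^m = 1` with `m` prime and, for every
point `l` moved by `σ`, `∑_{k<m} f(σᵏ l) = 0`, then `∑_l f(l) = ∑_{σ l = l} f(l)`: the moved points split into
`σ`-orbits of exact size `m` (an orbit `{σᵏ l}_{k<m}` has no repetitions, since `σᵈ` with `0 < d < m` fixing a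
point forces `σ` to fix it, `gcd(d, m) = 1`), and each orbit sums to zero.  (Used for the elliptic terms of
the trace of `T_p`, Knapp Prop. 11.23: `K·T(n)[γ] = T(n)[γᴷ]`.) [cite: Knapp1993, Prop. 11.23 proof (PDF pp. 244–245)] -/
theorem sum_eq_sum_filter_fixed_of_pow_prime_eq_one {ι A : Type*} [Fintype ι] [DecidableEq ι]
    [AddCommMonoid A] (σ : Equiv.Perm ι) {m : ℕ} (hm : m.Prime) (hσ : σ ^ m = 1) (f : ι → A)
    (hf : ∀ l, σ l ≠ l → ∑ k ∈ Finset.range m, f ((σ ^ k) l) = 0) :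
    ∑ l, f l = ∑ l ∈ Finset.univ.filter (fun l ↦ σ l = l), f l := by
  classical
  -- every `σ`-stable finite set of moved points has sum zero
  suffices key : ∀ (n : ℕ) (S : Finset ι), S.card = n → (∀ l ∈ S, σ l ≠ l) → (∀ l ∈ S, σ l ∈ S) →
      ∑ l ∈ S, f l = 0 by
    rw [← Finset.sum_filter_add_sum_filter_not Finset.univ (fun l ↦ σ l = l),
      key _ (Finset.univ.filter fun l ↦ ¬σ l = l) rfl (by simp) (fun l hl ↦ ?_), add_zero]
    simp only [Finset.mem_filter, Finset.mem_univ, true_and] at hl ⊢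
    exact fun h ↦ hl (σ.injective h)
  intro n
  induction n using Nat.strong_induction_on with
  | _ n IH =>
  intro S hcard hnf hst
  rcases S.eq_empty_or_nonempty with rfl | ⟨l, hl⟩
  · simp
  -- reduction of exponents modulo `m`
  have hpowmod : ∀ e : ℕ, σ ^ (e % m) = σ ^ e := fun e ↦ by
    conv_rhs => rw [← Nat.mod_add_div e m, pow_add, pow_mul, hσ, one_pow, mul_one]
  -- the orbit of `l`
  set O : Finset ι := (Finset.range m).image fun k ↦ (σ ^ k) l with hO
  have horb : ∀ k : ℕ, (σ ^ k) l ∈ S := fun k ↦ by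
    induction k with
    | zero => simpa using hl
    | succ k ih => rw [pow_succ', Equiv.Perm.mul_apply]; exact hst _ ih
  have hOS : O ⊆ S := by
    intro x hx
    obtain ⟨k, -, rfl⟩ := Finset.mem_image.mp hx
    exact horb k
  -- no repetitions in an orbit of a moved point: `σⁱ l = σʲ l`, `i < j < m` is impossible
  have aux : ∀ i j : ℕ, j < m → (σ ^ i) l = (σ ^ j) l → i < j → False := by
    intro i j hj hij hlt
    set d := j - i with hd
    have hd0 : 0 < d := Nat.sub_pos_of_lt hlt
    have hdm : d < m := lt_of_le_of_lt (Nat.sub_le j i) hj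
    have hfix : (σ ^ d) ((σ ^ i) l) = (σ ^ i) l := by
      rw [← Equiv.Perm.mul_apply, ← pow_add, hd, Nat.sub_add_cancel hlt.le, ← hij]
    have hcop : Nat.Coprime d m :=
      Nat.coprime_comm.mp ((Nat.Prime.coprime_iff_not_dvd hm).mpr fun h ↦
        absurd (Nat.le_of_dvd hd0 h) (not_le.mpr hdm))
    obtain ⟨a, -, ha⟩ := Nat.exists_mul_mod_eq_one_of_coprime hcop hm.one_lt
    have hσda : σ ^ (d * a) = σ := by rw [← hpowmod, ha, pow_one]
    have hfix1 : σ ((σ ^ i) l) = (σ ^ i) l := by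
      have h := Equiv.Perm.pow_apply_eq_self_of_apply_eq_self hfix a
      rwa [← pow_mul, hσda] at h
    exact hnf _ (horb i) hfix1
  have hinj : ∀ i ∈ Finset.range m, ∀ j ∈ Finset.range m,
      (fun k ↦ (σ ^ k) l) i = (fun k ↦ (σ ^ k) l) j → i = j := by
    intro i hi j hj hij
    simp only [Finset.mem_range] at hi hj hij
    by_contra hne
    rcases lt_or_gt_of_ne hne with hlt | hlt
    · exact aux i j hj hij hlt
    · exact aux j i hi hij.symm hlt
  have hOsum : ∑ x ∈ O, f x = 0 := by
    rw [hO, Finset.sum_image hinj]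
    exact hf l (hnf l hl)
  have hlO : l ∈ O := Finset.mem_image.mpr ⟨0, Finset.mem_range.mpr hm.pos, by simp⟩
  have hcard' : (S \ O).card < n := hcard ▸ Finset.card_lt_card (Finset.sdiff_ssubset hOS ⟨l, hlO⟩)
  have hst' : ∀ x ∈ S \ O, σ x ∈ S \ O := by
    intro x hx
    rw [Finset.mem_sdiff] at hx ⊢
    refine ⟨hst x hx.1, fun hσx ↦ hx.2 ?_⟩
    obtain ⟨k, -, hkx⟩ := Finset.mem_image.mp hσx
    refine Finset.mem_image.mpr ⟨(m - 1 + k) % m, Finset.mem_range.mpr (Nat.mod_lt _ hm.pos), ?_⟩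
    have h2 : σ ^ (m - 1) * σ = 1 := by rw [← pow_succ, Nat.sub_add_cancel hm.one_lt.le, hσ]
    rw [hpowmod, pow_add, Equiv.Perm.mul_apply, hkx, ← Equiv.Perm.mul_apply, h2, Equiv.Perm.one_apply]
  rw [← Finset.sum_sdiff hOS, hOsum, add_zero]
  exact IH _ hcard' (S \ O) rfl (fun x hx ↦ hnf x (Finset.mem_sdiff.mp hx).1) hst'

end PermOrbits

section Orbits

variable (N : ℕ) [NeZero N] (h9 : 3 ^ 2 ∣ N) {p : ℕ} [NeZero p] (hp : p.Prime)

omit [NeZero p] in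
/-- **An element commuting with `βᵢ` fixes the coset `i`**: if `γ βᵢ = βᵢ γ` then `σ_γ(i) = i`
(uniqueness of the coset index). [cite: Shimura1971, §8.3 p. 237] -/
theorem heckePerm_eq_self_of_commute {L : ℕ} (γ : Gamma0 L) (i : HeckeIdx L p)
    (h : ((γ : SL(2, ℤ)) : Matrix (Fin 2) (Fin 2) ℤ) * heckeRep p i.1 =
      heckeRep p i.1 * ((γ : SL(2, ℤ)) : Matrix (Fin 2) (Fin 2) ℤ)) :
    heckePerm hp γ i = i :=
  (existsUnique_heckeRep_mul_coe hp γ i).unique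
    ⟨_, coe_mem_delta0_one (heckePermElt hp γ i), heckePermElt_spec hp γ i⟩ ⟨_, coe_mem_delta0_one γ, h⟩

omit [NeZero p] in
/-- `σ_1 = id`. [cite: Shimura1971, §8.3 p. 237] -/
@[simp] theorem heckePerm_one {L : ℕ} (i : HeckeIdx L p) : heckePerm hp (1 : Gamma0 L) i = i :=
  heckePerm_eq_self_of_commute hp 1 i (by simp)

omit [NeZero p] in
/-- `σ_{-1} = id` (for an element of `Γ₀(L)` whose matrix is `-1`). [cite: Shimura1971, §8.3 p. 237] -/
theorem heckePerm_eq_self_of_coe_eq_neg_one {L : ℕ} {γ : Gamma0 L} (hγ : (γ : SL(2, ℤ)) = -1)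
    (i : HeckeIdx L p) : heckePerm hp γ i = i :=
  heckePerm_eq_self_of_commute hp γ i (by
    rw [hγ, Matrix.SpecialLinearGroup.coe_neg, Matrix.SpecialLinearGroup.coe_one]; simp)

/-- **`σ_{γᵏ} = σ_γᵏ`.** [cite: Shimura1971, §8.3 p. 237] -/
theorem heckePerm_pow {L : ℕ} (γ : Gamma0 L) (k : ℕ) (i : HeckeIdx L p) :
    heckePerm hp (γ ^ k) i = ((heckePermEquiv hp γ) ^ k) i := by
  induction k with
  | zero => rw [pow_zero, pow_zero, Equiv.Perm.one_apply, heckePerm_one]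
  | succ k ih =>
    rw [pow_succ, HidaCohomology.heckePerm_mul, ih, pow_succ', Equiv.Perm.mul_apply, heckePermEquiv_apply]

/-- `Ψ̄(xy) = Ψ̄(x) + Ψ̄(y)` in `Λ_N/Λ₁`. [cite: Manin1972, §1.5 and Prop. 1.4] -/
theorem mkQ_liftedSymbol_mul (x y : Gamma0 (N / 3)) :
    (shiftSubOneLattice N h9).mkQ (liftedSymbol N h9 (x * y)) =
      (shiftSubOneLattice N h9).mkQ (liftedSymbol N h9 x) + (shiftSubOneLattice N h9).mkQ (liftedSymbol N h9 y) := by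
  rw [← map_add, Submodule.mkQ_apply, Submodule.mkQ_apply, Submodule.Quotient.eq, ← sub_sub]
  exact liftedSymbol_mul_sub_sub_mem N h9 x y

/-- **`Ψ̄((gᵐ)'_l) = ∑_{k<m} Ψ̄(g'_{σ_gᵏ l})`**: the cocycle identity `(γδ)'_l = γ'_l δ'_{σ_γ l}` iterated
along the `σ_g`-orbit of `l`. [cite: Knapp1993, Prop. 11.23 proof (PDF pp. 244–245)] -/
theorem mkQ_liftedSymbol_heckePermElt_pow (g : Gamma0 (N / 3)) (m : ℕ) (l : HeckeIdx (N / 3) p) :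
    (shiftSubOneLattice N h9).mkQ (liftedSymbol N h9 (heckePermElt hp (g ^ m) l)) =
      ∑ k ∈ Finset.range m, (shiftSubOneLattice N h9).mkQ
        (liftedSymbol N h9 (heckePermElt hp g (((heckePermEquiv hp g) ^ k) l))) := by
  induction m with
  | zero =>
    rw [Finset.sum_range_zero, pow_zero, liftedSymbol_eq_zero_of_apply_one_zero N h9
      ((heckePermElt_apply_one_zero_eq_zero_iff hp _ l).mpr (by simp)), map_zero]
  | succ m ih =>
    rw [Finset.sum_range_succ, pow_succ, HidaCohomology.heckePermElt_mul, mkQ_liftedSymbol_mul, ih,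
      heckePerm_pow]

/-- **The trace of an element of prime order modulo `±1` is carried by its fixed cosets**: if `m` is prime,
`σ_{gᵐ} = id` and `gᵐ` fixes `∞` (e.g. `gᵐ = ±1`: `g` elliptic of order `m ∈ {2, 3}` in `PSL₂(ℤ)`), then
`∑_{l ∈ I_p(N/3)} Ψ̄(g'_l) = ∑_{σ_g l = l} Ψ̄(g'_l)` — every non-trivial `σ_g`-orbit has size `m` and contributes
`Ψ̄((gᵐ)'_l) = 0`. [cite: Knapp1993, Prop. 11.23 proof (PDF pp. 244–245)] -/
theorem sum_mkQ_liftedSymbol_heckePermElt_eq_sum_filter_fixed (g : Gamma0 (N / 3)) {m : ℕ} (hm : m.Prime)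
    (hσ : ∀ l : HeckeIdx (N / 3) p, heckePerm hp (g ^ m) l = l)
    (hc : ((g ^ m : Gamma0 (N / 3)) : SL(2, ℤ)) 1 0 = 0) :
    ∑ l : HeckeIdx (N / 3) p, (shiftSubOneLattice N h9).mkQ (liftedSymbol N h9 (heckePermElt hp g l)) =
      ∑ l ∈ Finset.univ.filter (fun l ↦ heckePerm hp g l = l),
        (shiftSubOneLattice N h9).mkQ (liftedSymbol N h9 (heckePermElt hp g l)) := by
  classical
  have hσm : (heckePermEquiv hp g) ^ m = 1 := by
    ext l
    rw [Equiv.Perm.one_apply, ← heckePerm_pow, hσ]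
  have hf : ∀ l, heckePermEquiv hp g l ≠ l → ∑ k ∈ Finset.range m, (shiftSubOneLattice N h9).mkQ
      (liftedSymbol N h9 (heckePermElt hp g (((heckePermEquiv hp g) ^ k) l))) = 0 := by
    intro l _
    rw [← mkQ_liftedSymbol_heckePermElt_pow, liftedSymbol_eq_zero_of_apply_one_zero N h9
      ((heckePermElt_apply_one_zero_eq_zero_iff hp _ l).mpr hc), map_zero]
  simpa only [heckePermEquiv_apply] using sum_eq_sum_filter_fixed_of_pow_prime_eq_one (heckePermEquiv hp g)
    hm hσm (fun l ↦ (shiftSubOneLattice N h9).mkQ (liftedSymbol N h9 (heckePermElt hp g l))) hf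

/-- The trace identity in quotient form: `∑_l Ψ(e'_l) − 2Ψ(e) ∈ Λ₁ ↔ ∑_l Ψ̄(e'_l) = 2Ψ̄(e)`. [cite: Knapp1993, (11.38), Prop. 11.23 and (11.39a) (PDF p. 244)] -/
theorem sum_liftedSymbol_heckePermElt_sub_two_smul_mem_iff (e : Gamma0 (N / 3)) :
    ∑ l : HeckeIdx (N / 3) p, liftedSymbol N h9 (heckePermElt hp e l) - 2 • liftedSymbol N h9 e ∈
        shiftSubOneLattice N h9 ↔
      ∑ l : HeckeIdx (N / 3) p, (shiftSubOneLattice N h9).mkQ (liftedSymbol N h9 (heckePermElt hp e l)) =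
        2 • (shiftSubOneLattice N h9).mkQ (liftedSymbol N h9 e) := by
  rw [← map_sum, ← map_nsmul, Submodule.mkQ_apply, Submodule.mkQ_apply, Submodule.Quotient.eq]

/-- The trace identity for elements fixing `∞` (`c = 0`, e.g. `e = ±1`, `±Tᵏ`): both sides vanish.
[cite: Knapp1993, Prop. 11.23 proof (PDF pp. 244–245)] -/
theorem sum_liftedSymbol_heckePermElt_sub_two_smul_mem_of_apply_one_zero {e : Gamma0 (N / 3)}
    (he : (e : SL(2, ℤ)) 1 0 = 0) :
    ∑ l : HeckeIdx (N / 3) p, liftedSymbol N h9 (heckePermElt hp e l) - 2 • liftedSymbol N h9 e ∈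
      shiftSubOneLattice N h9 := by
  rw [sum_liftedSymbol_heckePermElt_eq_zero_of_apply_one_zero N h9 hp he,
    liftedSymbol_eq_zero_of_apply_one_zero N h9 he, smul_zero, sub_zero]
  exact zero_mem _

end Orbits

/-! ### The fixed cosets of an elliptic element: the norm-`p` elements `λ = x + y e` of `ℤ[e]` -/

section NormElements

variable {L : ℕ} {p : ℕ} (hp : p.Prime)

/-- **The element `x + y E ∈ ℤ[E] ⊆ M₂(ℤ)`** (as an explicit matrix). For `E` elliptic, `ℤ[E] ≅ ℤ[i]` or
`ℤ[ω]` and `det(x + yE) = x² + xy·tr E + y²` is its norm form. [cite: Shimura1971, §1.3] -/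
def normElt (x y : ℤ) (E : Matrix (Fin 2) (Fin 2) ℤ) : Matrix (Fin 2) (Fin 2) ℤ :=
  !![x + y * E 0 0, y * E 0 1; y * E 1 0, x + y * E 1 1]

/-- `x + yE` commutes with `E`. [cite: Shimura1971, §1.3] -/
theorem normElt_mul_comm (x y : ℤ) (E : Matrix (Fin 2) (Fin 2) ℤ) : normElt x y E * E = E * normElt x y E := by
  ext i j
  fin_cases i <;> fin_cases j <;> simp [normElt, Matrix.mul_apply, Fin.sum_univ_two] <;> ring

/-- **`det(x + y e) = x² + xy·tr(e) + y²`** for `e ∈ SL₂(ℤ)`. [cite: Shimura1971, §1.3] -/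
theorem det_normElt (x y : ℤ) (γ : SL(2, ℤ)) :
    (normElt x y (γ : Matrix (Fin 2) (Fin 2) ℤ)).det = x ^ 2 + x * y * (γ 0 0 + γ 1 1) + y ^ 2 := by
  have hdet := γ.det_coe
  rw [Matrix.det_fin_two] at hdet
  rw [Matrix.det_fin_two]
  simp only [normElt, Matrix.of_apply, Matrix.cons_val', Matrix.cons_val_zero, Matrix.cons_val_one,
    Matrix.cons_val_fin_one]
  linear_combination y ^ 2 * hdet

/-- **`(x + y e)·((x + y tr e) − y e) = N(x + y e)·1`**: the product with the conjugate element.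
[cite: Shimura1971, §1.3] -/
theorem normElt_mul_adj (x y : ℤ) (γ : SL(2, ℤ)) :
    normElt x y (γ : Matrix (Fin 2) (Fin 2) ℤ) * normElt (x + y * (γ 0 0 + γ 1 1)) (-y) (γ : Matrix (Fin 2) (Fin 2) ℤ) =
      !![x ^ 2 + x * y * (γ 0 0 + γ 1 1) + y ^ 2, 0; 0, x ^ 2 + x * y * (γ 0 0 + γ 1 1) + y ^ 2] := by
  have hdet := γ.det_coe
  rw [Matrix.det_fin_two] at hdet
  ext i j
  fin_cases i <;> fin_cases j <;> simp [normElt, Matrix.mul_apply, Fin.sum_univ_two] <;>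
    first | linear_combination y ^ 2 * hdet | ring1

/-- Entries of `K · diag(q, q)` (plumbing). [folklore] -/
private theorem mul_diag_apply (K : Matrix (Fin 2) (Fin 2) ℤ) (q : ℤ) (i j : Fin 2) :
    (K * !![q, 0; 0, q]) i j = K i j * q := by
  fin_cases i <;> fin_cases j <;> simp [Matrix.mul_apply, Fin.sum_univ_two]

include hp in
/-- **No norm-`p` element has a square divisible by `p`** when `p ∤ tr(e)² − 4`: if `N(x + y e) = p` and
`p` divides every entry of `(x + y e)²`, contradiction (`p ∣ y` forces `p² ∣ N`; `p ∤ y` forces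
`p ∣ tr² − 4`).  This separates the cosets `Γ₀ λ ≠ Γ₀ λ̄`. [cite: Shimura1971, §1.3] -/
theorem false_of_prime_dvd_normElt_sq (γ : SL(2, ℤ)) (x y : ℤ)
    (hN : x ^ 2 + x * y * (γ 0 0 + γ 1 1) + y ^ 2 = p)
    (hdisc : ¬(p : ℤ) ∣ (γ 0 0 + γ 1 1) ^ 2 - 4)
    (hdiv : ∀ i j, (p : ℤ) ∣ (normElt x y (γ : Matrix (Fin 2) (Fin 2) ℤ) *
      normElt x y (γ : Matrix (Fin 2) (Fin 2) ℤ)) i j) : False := by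
  have hp' : Prime (p : ℤ) := Nat.prime_iff_prime_int.mp hp
  have hdet := γ.det_coe
  rw [Matrix.det_fin_two] at hdet
  have h00 := hdiv 0 0
  have h01 := hdiv 0 1
  have h10 := hdiv 1 0
  have h11 := hdiv 1 1
  simp only [normElt, Matrix.mul_apply, Fin.sum_univ_two, Matrix.of_apply, Matrix.cons_val',
    Matrix.cons_val_zero, Matrix.cons_val_one, Matrix.cons_val_fin_one] at h00 h01 h10 h11
  set a := (γ : Matrix (Fin 2) (Fin 2) ℤ) 0 0
  set b := (γ : Matrix (Fin 2) (Fin 2) ℤ) 0 1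
  set c := (γ : Matrix (Fin 2) (Fin 2) ℤ) 1 0
  set d := (γ : Matrix (Fin 2) (Fin 2) ℤ) 1 1
  set s := 2 * x + y * (a + d) with hs
  have h01' : (p : ℤ) ∣ y * b * s := by
    have : y * b * s = (x + y * a) * (y * b) + y * b * (x + y * d) := by rw [hs]; ring
    rw [this]; exact h01
  have h10' : (p : ℤ) ∣ y * c * s := by
    have : y * c * s = y * c * (x + y * a) + (x + y * d) * (y * c) := by rw [hs]; ring
    rw [this]; exact h10
  have hdiff : (p : ℤ) ∣ y * (a - d) * s := by
    have : y * (a - d) * s = ((x + y * a) * (x + y * a) + y * b * (y * c)) -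
        (y * c * (y * b) + (x + y * d) * (x + y * d)) := by rw [hs]; ring
    rw [this]; exact dvd_sub h00 h11
  by_cases hy : (p : ℤ) ∣ y
  · -- then `p ∣ x`, and `p² ∣ N = p`
    have hxa : (p : ℤ) ∣ (x + y * a) ^ 2 := by
      have : (x + y * a) ^ 2 = ((x + y * a) * (x + y * a) + y * b * (y * c)) - y * (b * (y * c)) := by ring
      rw [this]; exact dvd_sub h00 (dvd_mul_of_dvd_left hy _)
    have hx : (p : ℤ) ∣ x := by
      have h1 := hp'.dvd_of_dvd_pow hxa
      have : x = (x + y * a) - y * a := by ring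
      rw [this]; exact dvd_sub h1 (dvd_mul_of_dvd_left hy _)
    have hpp : (p : ℤ) * p ∣ (p : ℤ) := by
      have : (p : ℤ) = x * x + x * y * (a + d) + y * y := by rw [← hN]; ring
      conv_rhs => rw [this]
      exact dvd_add (dvd_add (mul_dvd_mul hx hx) (dvd_mul_of_dvd_left (mul_dvd_mul hx hy) _))
        (mul_dvd_mul hy hy)
    have hp1 : (p : ℤ) ∣ 1 := by
      have hp0 : (p : ℤ) ≠ 0 := by exact_mod_cast hp.ne_zero
      obtain ⟨k, hk⟩ := hpp
      exact ⟨k, mul_left_cancel₀ hp0 (by linear_combination hk)⟩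
    exact hp.one_lt.ne' (by exact_mod_cast Int.eq_one_of_dvd_one (Int.natCast_nonneg p) hp1)
  · by_cases hsd : (p : ℤ) ∣ s
    · -- `4N = s² − y²(tr² − 4)`
      have h4 : y ^ 2 * ((a + d) ^ 2 - 4) = s ^ 2 - 4 * p := by rw [hs, ← hN]; ring
      have : (p : ℤ) ∣ y ^ 2 * ((a + d) ^ 2 - 4) := by
        rw [h4]; exact dvd_sub (dvd_pow hsd two_ne_zero) (dvd_mul_left _ _)
      rcases hp'.dvd_or_dvd this with h | h
      · exact hy (hp'.dvd_of_dvd_pow h)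
      · exact hdisc h
    · have key : ∀ z : ℤ, (p : ℤ) ∣ y * z * s → (p : ℤ) ∣ z := fun z hz ↦ by
        rcases hp'.dvd_or_dvd hz with h | h
        · rcases hp'.dvd_or_dvd h with h | h
          · exact absurd h hy
          · exact h
        · exact absurd h hsd
      have hb := key b h01'
      have hc := key c h10'
      have had := key (a - d) hdiff
      apply hdisc
      have : (a + d) ^ 2 - 4 = (a - d) * (a - d) + 4 * b * c := by linear_combination 4 * hdet
      rw [this]
      exact dvd_add (dvd_mul_of_dvd_left had _) (dvd_mul_of_dvd_right hc _)

include hp in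
/-- **A norm-`p` element `λ = u + v e ∈ ℤ[e]` produces a fixed coset with `e'_l` conjugate to `e` in `Γ₀(L)`.**
For `e ∈ Γ₀(L)`, `p ∤ L` and `u² + uv·tr(e) + v² = p`, the matrix `λ = u + v e` lies in `Δ₀ᴸ(p)`, hence
`λ = g β_l` for a unique coset `l ∈ I_p(L)` and some `g ∈ Γ₀(L)`; since `λ` commutes with `e`,
`β_l e = (g⁻¹ e g) β_l`, so `σ_e(l) = l` and `e'_l = g⁻¹ e g`.  (The CM fixed points of the Hecke
correspondence.) [cite: Shimura1971, §1.3 and §8.3 p. 237] -/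
theorem exists_heckePerm_eq_self_of_norm_eq (e : Gamma0 L) (u v : ℤ)
    (huv : u ^ 2 + u * v * ((e : SL(2, ℤ)) 0 0 + (e : SL(2, ℤ)) 1 1) + v ^ 2 = p) (hpL : ¬p ∣ L) :
    ∃ (l : HeckeIdx L p) (g : Gamma0 L), heckePerm hp e l = l ∧ heckePermElt hp e l = g⁻¹ * e * g ∧
      ((g : SL(2, ℤ)) : Matrix (Fin 2) (Fin 2) ℤ) * heckeRep p l.1 =
        normElt u v ((e : SL(2, ℤ)) : Matrix (Fin 2) (Fin 2) ℤ) := by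
  set E : Matrix (Fin 2) (Fin 2) ℤ := ((e : SL(2, ℤ)) : Matrix (Fin 2) (Fin 2) ℤ) with hE
  set lam : Matrix (Fin 2) (Fin 2) ℤ := normElt u v E with hlam
  obtain ⟨hEdet, hEc, -⟩ := coe_mem_delta0_one e
  have hEdet' : E 0 0 * E 1 1 - E 0 1 * E 1 0 = 1 := by rw [← Matrix.det_fin_two]; exact hEdet
  have hdet : lam.det = p := by
    rw [hlam, hE, det_normElt]; exact huv
  -- `λ ∈ Δ₀ᴸ(p)`
  have hlamD : lam ∈ Delta0 L (p * 1) := by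
    refine ⟨by rw [mul_one]; exact hdet, ?_, ?_⟩
    · simp only [hlam, normElt, Matrix.of_apply, Matrix.cons_val', Matrix.cons_val_zero, Matrix.cons_val_one,
        Matrix.cons_val_fin_one]
      exact Dvd.dvd.mul_left hEc v
    · obtain ⟨c', hc'⟩ := hEc
      rw [← hE] at hc'
      have hcopL : IsCoprime (p : ℤ) (L : ℤ) :=
        Nat.isCoprime_iff_coprime.mpr ((Nat.Prime.coprime_iff_not_dvd hp).mpr hpL)
      have h00 : lam 0 0 = u + v * E 0 0 := by
        simp [hlam, normElt]
      have key : lam 0 0 * (u + v * E 1 1) + (L : ℤ) * (-(v ^ 2 * E 0 1 * c')) = p := by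
        rw [h00, ← huv]
        linear_combination v ^ 2 * hEdet' + v ^ 2 * E 0 1 * hc'
      rw [← key] at hcopL
      exact hcopL.of_add_mul_left_left.of_mul_left_left
  obtain ⟨l, ⟨M', hM', hM'eq⟩, -⟩ :=
    existsUnique_mem_delta0_mul_heckeRep hp (D := 1) (not_intCast_dvd_one hp) hlamD
  obtain ⟨g', hg', hg'eq⟩ :=
    (exists_mem_delta0_one_iff (fun M ↦ M * heckeRep p l.1 = lam)).mp ⟨M', hM', hM'eq⟩
  set g : Gamma0 L := ⟨g', hg'⟩ with hgdef
  have hg : ((g : SL(2, ℤ)) : Matrix (Fin 2) (Fin 2) ℤ) * heckeRep p l.1 = lam := hg'eq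
  have hcomm : lam * E = E * lam := normElt_mul_comm u v E
  have hinv : (((g⁻¹ : Gamma0 L) : SL(2, ℤ)) : Matrix (Fin 2) (Fin 2) ℤ) *
      ((g : SL(2, ℤ)) : Matrix (Fin 2) (Fin 2) ℤ) = 1 := by
    rw [← Matrix.SpecialLinearGroup.coe_mul, Subgroup.coe_inv, inv_mul_cancel, Matrix.SpecialLinearGroup.coe_one]
  have hcoe : (((g⁻¹ * e * g : Gamma0 L) : SL(2, ℤ)) : Matrix (Fin 2) (Fin 2) ℤ) =
      (((g⁻¹ : Gamma0 L) : SL(2, ℤ)) : Matrix (Fin 2) (Fin 2) ℤ) * E * ((g : SL(2, ℤ)) : Matrix (Fin 2) (Fin 2) ℤ) := by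
    simp only [Subgroup.coe_mul, Matrix.SpecialLinearGroup.coe_mul, hE]
  have hrel : (((g⁻¹ * e * g : Gamma0 L) : SL(2, ℤ)) : Matrix (Fin 2) (Fin 2) ℤ) * heckeRep p l.1 =
      heckeRep p l.1 * E := by
    rw [hcoe]
    calc (((g⁻¹ : Gamma0 L) : SL(2, ℤ)) : Matrix (Fin 2) (Fin 2) ℤ) * E *
          ((g : SL(2, ℤ)) : Matrix (Fin 2) (Fin 2) ℤ) * heckeRep p l.1
          = (((g⁻¹ : Gamma0 L) : SL(2, ℤ)) : Matrix (Fin 2) (Fin 2) ℤ) * (E *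
            (((g : SL(2, ℤ)) : Matrix (Fin 2) (Fin 2) ℤ) * heckeRep p l.1)) := by simp only [Matrix.mul_assoc]
      _ = (((g⁻¹ : Gamma0 L) : SL(2, ℤ)) : Matrix (Fin 2) (Fin 2) ℤ) * (lam * E) := by rw [hg, hcomm]
      _ = (((g⁻¹ : Gamma0 L) : SL(2, ℤ)) : Matrix (Fin 2) (Fin 2) ℤ) *
            ((((g : SL(2, ℤ)) : Matrix (Fin 2) (Fin 2) ℤ) * heckeRep p l.1) * E) := by rw [hg]
      _ = (((g⁻¹ : Gamma0 L) : SL(2, ℤ)) : Matrix (Fin 2) (Fin 2) ℤ) *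
            ((g : SL(2, ℤ)) : Matrix (Fin 2) (Fin 2) ℤ) * heckeRep p l.1 * E := by simp only [Matrix.mul_assoc]
      _ = heckeRep p l.1 * E := by rw [hinv, Matrix.one_mul]
  have hσ : heckePerm hp e l = l :=
    (existsUnique_heckeRep_mul_coe hp e l).unique
      ⟨_, coe_mem_delta0_one _, heckePermElt_spec hp e l⟩ ⟨_, coe_mem_delta0_one (g⁻¹ * e * g), hrel⟩
  have hh : heckePermElt hp e l = g⁻¹ * e * g := by
    have h1 := heckePermElt_spec hp e l
    rw [hσ, ← hE, ← hrel] at h1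
    have h2 := matrix_mul_right_cancel_of_det_ne_zero (det_heckeRep_ne_zero hp.ne_zero _) h1
    exact Subtype.ext (Matrix.SpecialLinearGroup.ext _ _ fun i j ↦ congrFun (congrFun h2 i) j)
  exact ⟨l, g, hσ, hh, hg⟩

include hp in
/-- **The norm-`p` elements `λ = u + v e` and `λ̄ = (u + v tr e) − v e` give different cosets**
(`p ∤ tr(e)² − 4`): if `g₁ β_{l} = λ` and `g₂ β_{l} = λ̄` for the same `l`, then `λ̄² = g₂g₁⁻¹ λ λ̄ = p·g₂g₁⁻¹`
has all entries divisible by `p`, contradicting `false_of_prime_dvd_normElt_sq`. [cite: Shimura1971, §1.3 and §8.3 p. 237] -/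
theorem heckeIdx_ne_of_norm_eq (e : Gamma0 L) (u v : ℤ)
    (huv : u ^ 2 + u * v * ((e : SL(2, ℤ)) 0 0 + (e : SL(2, ℤ)) 1 1) + v ^ 2 = p)
    (hdisc : ¬(p : ℤ) ∣ ((e : SL(2, ℤ)) 0 0 + (e : SL(2, ℤ)) 1 1) ^ 2 - 4)
    {l₁ l₂ : HeckeIdx L p} {g₁ g₂ : Gamma0 L}
    (h₁ : ((g₁ : SL(2, ℤ)) : Matrix (Fin 2) (Fin 2) ℤ) * heckeRep p l₁.1 =
      normElt u v ((e : SL(2, ℤ)) : Matrix (Fin 2) (Fin 2) ℤ))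
    (h₂ : ((g₂ : SL(2, ℤ)) : Matrix (Fin 2) (Fin 2) ℤ) * heckeRep p l₂.1 =
      normElt (u + v * ((e : SL(2, ℤ)) 0 0 + (e : SL(2, ℤ)) 1 1)) (-v) ((e : SL(2, ℤ)) : Matrix (Fin 2) (Fin 2) ℤ)) :
    l₁ ≠ l₂ := by
  rintro rfl
  set E : Matrix (Fin 2) (Fin 2) ℤ := ((e : SL(2, ℤ)) : Matrix (Fin 2) (Fin 2) ℤ) with hE
  set t : ℤ := (e : SL(2, ℤ)) 0 0 + (e : SL(2, ℤ)) 1 1 with ht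
  set lam : Matrix (Fin 2) (Fin 2) ℤ := normElt u v E with hlam
  set mu : Matrix (Fin 2) (Fin 2) ℤ := normElt (u + v * t) (-v) E with hmu
  have hprod : lam * mu = !![(p : ℤ), 0; 0, (p : ℤ)] := by
    rw [hlam, hmu, hE, ht, normElt_mul_adj, huv]
  have hinv : (((g₁⁻¹ : Gamma0 L) : SL(2, ℤ)) : Matrix (Fin 2) (Fin 2) ℤ) *
      ((g₁ : SL(2, ℤ)) : Matrix (Fin 2) (Fin 2) ℤ) = 1 := by
    rw [← Matrix.SpecialLinearGroup.coe_mul, Subgroup.coe_inv, inv_mul_cancel, Matrix.SpecialLinearGroup.coe_one]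
  have hβ : heckeRep p l₁.1 = (((g₁⁻¹ : Gamma0 L) : SL(2, ℤ)) : Matrix (Fin 2) (Fin 2) ℤ) * lam := by
    rw [← h₁, ← Matrix.mul_assoc, hinv, Matrix.one_mul]
  have hmu2 : mu * mu = ((g₂ : SL(2, ℤ)) : Matrix (Fin 2) (Fin 2) ℤ) *
      (((g₁⁻¹ : Gamma0 L) : SL(2, ℤ)) : Matrix (Fin 2) (Fin 2) ℤ) * !![(p : ℤ), 0; 0, (p : ℤ)] := by
    calc mu * mu = ((g₂ : SL(2, ℤ)) : Matrix (Fin 2) (Fin 2) ℤ) * heckeRep p l₁.1 * mu := by rw [h₂]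
      _ = ((g₂ : SL(2, ℤ)) : Matrix (Fin 2) (Fin 2) ℤ) *
            (((g₁⁻¹ : Gamma0 L) : SL(2, ℤ)) : Matrix (Fin 2) (Fin 2) ℤ) * (lam * mu) := by
          rw [hβ]; simp only [Matrix.mul_assoc]
      _ = ((g₂ : SL(2, ℤ)) : Matrix (Fin 2) (Fin 2) ℤ) *
            (((g₁⁻¹ : Gamma0 L) : SL(2, ℤ)) : Matrix (Fin 2) (Fin 2) ℤ) * !![(p : ℤ), 0; 0, (p : ℤ)] := by
          rw [hprod]
  -- the norm of `μ = (u + vt) − v e` is also `p`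
  have hN : (u + v * t) ^ 2 + (u + v * t) * (-v) * ((e : SL(2, ℤ)) 0 0 + (e : SL(2, ℤ)) 1 1) + (-v) ^ 2 = p := by
    rw [← huv, ← ht]; ring
  refine false_of_prime_dvd_normElt_sq hp (e : SL(2, ℤ)) (u + v * t) (-v) hN hdisc fun i j ↦ ?_
  rw [← hE, ← hmu, hmu2, mul_diag_apply]
  exact dvd_mul_left _ _

end NormElements

/-! ### The fixed cosets of `σ_e`: at most two when `p ∤ tr(e)² − 4` -/

section FixedCosets

variable {L : ℕ} {p : ℕ} (hp : p.Prime)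
include hp

/-- **A fixed affine coset is a root of `c j² + (a − d) j − b ≡ 0 (mod p)`**: if `σ_e(j) = j` for
`βⱼ = (1 j; 0 p)` then `βⱼ e βⱼ⁻¹ = (a + jc, (b + jd − j(a + jc))/p; pc, d − jc)` is integral.
[cite: Shimura1971, §8.3 p. 237] -/
theorem dvd_quadratic_of_heckePerm_some_eq_self (e : Gamma0 L) (j : ZMod p)
    (hj : (some j : Option (ZMod p)) = none → ¬p ∣ L) (hfix : heckePerm hp e ⟨some j, hj⟩ = ⟨some j, hj⟩) :
    (p : ℤ) ∣ (e : SL(2, ℤ)) 1 0 * (j.val : ℤ) ^ 2 + ((e : SL(2, ℤ)) 0 0 - (e : SL(2, ℤ)) 1 1) * (j.val : ℤ) -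
      (e : SL(2, ℤ)) 0 1 := by
  have h := heckePermElt_spec hp e ⟨some j, hj⟩
  rw [hfix] at h
  simp only at h
  rw [mul_heckeRep_some, heckeRep_some_mul] at h
  have h00 := congrFun (congrFun h 0) 0
  have h01 := congrFun (congrFun h 0) 1
  simp only [Matrix.of_apply, Matrix.cons_val', Matrix.cons_val_zero, Matrix.cons_val_one,
    Matrix.cons_val_fin_one] at h00 h01
  refine ⟨-((heckePermElt hp e ⟨some j, hj⟩ : SL(2, ℤ)) 0 1), ?_⟩
  rw [h00] at h01
  linear_combination h01

/-- **The coset `∞` is fixed only if `p ∣ c`**: `β_∞ e β_∞⁻¹ = (a, pb; c/p, d)`. [cite: Shimura1971, §8.3 p. 237] -/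
theorem dvd_apply_one_zero_of_heckePerm_none_eq_self (e : Gamma0 L)
    (hn : (none : Option (ZMod p)) = none → ¬p ∣ L) (hfix : heckePerm hp e ⟨none, hn⟩ = ⟨none, hn⟩) :
    (p : ℤ) ∣ (e : SL(2, ℤ)) 1 0 := by
  have h := heckePermElt_spec hp e ⟨none, hn⟩
  rw [hfix] at h
  simp only at h
  rw [mul_heckeRep_none, heckeRep_none_mul] at h
  have h10 := congrFun (congrFun h 1) 0
  simp only [Matrix.of_apply, Matrix.cons_val', Matrix.cons_val_zero, Matrix.cons_val_one,
    Matrix.cons_val_fin_one] at h10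
  exact ⟨(heckePermElt hp e ⟨none, hn⟩ : SL(2, ℤ)) 1 0, by rw [← h10, mul_comm]⟩

/-- **A fixed coset forces `tr(e)² − 4` to be a square mod `p`**: `(2cj + a − d)² ≡ (a − d)² + 4bc = tr² − 4`
for a fixed `j`, and `tr² − 4 ≡ (a − d)²` if `∞` is fixed (`p ∣ c`).  (So an elliptic `e` of trace `0` has no
fixed coset when `p ≡ 3 (mod 4)`.) [cite: Shimura1971, §1.3 and §8.3 p. 237] -/
theorem isSquare_of_heckePerm_eq_self (e : Gamma0 L) (l : HeckeIdx L p) (hfix : heckePerm hp e l = l) :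
    IsSquare (((((e : SL(2, ℤ)) 0 0 + (e : SL(2, ℤ)) 1 1) ^ 2 - 4 : ℤ)) : ZMod p) := by
  have hdet : (e : SL(2, ℤ)) 0 0 * (e : SL(2, ℤ)) 1 1 - (e : SL(2, ℤ)) 0 1 * (e : SL(2, ℤ)) 1 0 = 1 := by
    have := Matrix.det_fin_two ((e : SL(2, ℤ)) : Matrix (Fin 2) (Fin 2) ℤ)
    rw [Matrix.SpecialLinearGroup.det_coe] at this
    exact this.symm
  obtain ⟨_ | j, hl⟩ := l
  · obtain ⟨k, hk⟩ := dvd_apply_one_zero_of_heckePerm_none_eq_self hp e hl hfix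
    refine ⟨(((e : SL(2, ℤ)) 0 0 - (e : SL(2, ℤ)) 1 1 : ℤ) : ZMod p), ?_⟩
    have : (((e : SL(2, ℤ)) 0 0 + (e : SL(2, ℤ)) 1 1) ^ 2 - 4 : ℤ) =
        ((e : SL(2, ℤ)) 0 0 - (e : SL(2, ℤ)) 1 1) * ((e : SL(2, ℤ)) 0 0 - (e : SL(2, ℤ)) 1 1) +
          p * (4 * (e : SL(2, ℤ)) 0 1 * k) := by
      linear_combination (4 : ℤ) * hdet + 4 * (e : SL(2, ℤ)) 0 1 * hk
    rw [this]
    push_cast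
    simp
  · obtain ⟨k, hk⟩ := dvd_quadratic_of_heckePerm_some_eq_self hp e j hl hfix
    refine ⟨((2 * (e : SL(2, ℤ)) 1 0 * (j.val : ℤ) + ((e : SL(2, ℤ)) 0 0 - (e : SL(2, ℤ)) 1 1) : ℤ) : ZMod p), ?_⟩
    have : (((e : SL(2, ℤ)) 0 0 + (e : SL(2, ℤ)) 1 1) ^ 2 - 4 : ℤ) =
        (2 * (e : SL(2, ℤ)) 1 0 * (j.val : ℤ) + ((e : SL(2, ℤ)) 0 0 - (e : SL(2, ℤ)) 1 1)) *
          (2 * (e : SL(2, ℤ)) 1 0 * (j.val : ℤ) + ((e : SL(2, ℤ)) 0 0 - (e : SL(2, ℤ)) 1 1)) -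
          p * (4 * (e : SL(2, ℤ)) 1 0 * k) := by
      linear_combination (4 : ℤ) * hdet - 4 * (e : SL(2, ℤ)) 1 0 * hk
    rw [this]
    push_cast
    simp

omit hp in
/-- Three distinct roots of `c X² + u X + w` over a field force `c = u = 0` (plumbing). [folklore] -/
private theorem quadratic_three_roots {K : Type*} [Field K] {c u w j₁ j₂ j₃ : K}
    (h₁ : c * j₁ ^ 2 + u * j₁ + w = 0) (h₂ : c * j₂ ^ 2 + u * j₂ + w = 0) (h₃ : c * j₃ ^ 2 + u * j₃ + w = 0)
    (h12 : j₁ ≠ j₂) (h13 : j₁ ≠ j₃) (h23 : j₂ ≠ j₃) : c = 0 ∧ u = 0 := by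
  have e12 : (j₁ - j₂) * (c * (j₁ + j₂) + u) = 0 := by linear_combination h₁ - h₂
  have e13 : (j₁ - j₃) * (c * (j₁ + j₃) + u) = 0 := by linear_combination h₁ - h₃
  have f12 := (mul_eq_zero.mp e12).resolve_left (sub_ne_zero.mpr h12)
  have f13 := (mul_eq_zero.mp e13).resolve_left (sub_ne_zero.mpr h13)
  have hc : c * (j₂ - j₃) = 0 := by linear_combination f12 - f13
  have hc0 := (mul_eq_zero.mp hc).resolve_right (sub_ne_zero.mpr h23)
  exact ⟨hc0, by rw [hc0, zero_mul, zero_add] at f12; exact f12⟩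

omit hp in
/-- Two distinct roots of `u X + w` over a field force `u = 0` (plumbing). [folklore] -/
private theorem linear_two_roots {K : Type*} [Field K] {u w j₁ j₂ : K}
    (h₁ : u * j₁ + w = 0) (h₂ : u * j₂ + w = 0) (h12 : j₁ ≠ j₂) : u = 0 := by
  have e12 : u * (j₁ - j₂) = 0 := by linear_combination h₁ - h₂
  exact (mul_eq_zero.mp e12).resolve_right (sub_ne_zero.mpr h12)

/-- The root relation in `ZMod p` for a fixed affine coset (plumbing). [cite: Shimura1971, §8.3 p. 237] -/
private theorem zmod_root_of_fixed (e : Gamma0 L) (j : ZMod p)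
    (hj : (some j : Option (ZMod p)) = none → ¬p ∣ L) (hfix : heckePerm hp e ⟨some j, hj⟩ = ⟨some j, hj⟩) :
    (((e : SL(2, ℤ)) 1 0 : ℤ) : ZMod p) * j ^ 2 +
      ((((e : SL(2, ℤ)) 0 0 - (e : SL(2, ℤ)) 1 1 : ℤ)) : ZMod p) * j + (-(((e : SL(2, ℤ)) 0 1 : ℤ) : ZMod p)) = 0 := by
  haveI : NeZero p := ⟨hp.ne_zero⟩
  have h := (ZMod.intCast_zmod_eq_zero_iff_dvd _ p).mpr (dvd_quadratic_of_heckePerm_some_eq_self hp e j hj hfix)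
  push_cast at h
  rw [ZMod.natCast_zmod_val] at h
  push_cast
  linear_combination h

/-- **An element with `p ∤ tr(e)² − 4` has at most two fixed cosets** among `I_p(L)`: the fixed `j` are roots of
`c X² + (a − d) X − b` over `𝔽_p`, a nonzero polynomial of degree `≤ 2` (`≤ 1` when `p ∣ c`, the only case in
which `∞` is fixed).  For `e` elliptic these are its two CM fixed points (when `p` splits in `ℤ[e]`).
[cite: Shimura1971, §1.3 and §8.3 p. 237] -/
theorem card_filter_heckePerm_eq_self_le_two [NeZero p] (e : Gamma0 L)
    (hdisc : ¬(p : ℤ) ∣ ((e : SL(2, ℤ)) 0 0 + (e : SL(2, ℤ)) 1 1) ^ 2 - 4) :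
    (Finset.univ.filter fun l : HeckeIdx L p ↦ heckePerm hp e l = l).card ≤ 2 := by
  classical
  haveI : Fact p.Prime := ⟨hp⟩
  have hdet : (e : SL(2, ℤ)) 0 0 * (e : SL(2, ℤ)) 1 1 - (e : SL(2, ℤ)) 0 1 * (e : SL(2, ℤ)) 1 0 = 1 := by
    have := Matrix.det_fin_two ((e : SL(2, ℤ)) : Matrix (Fin 2) (Fin 2) ℤ)
    rw [Matrix.SpecialLinearGroup.det_coe] at this
    exact this.symm
  -- `c̄` and `ā − d̄` are not both zero
  have hne : ¬((((e : SL(2, ℤ)) 1 0 : ℤ) : ZMod p) = 0 ∧ ((((e : SL(2, ℤ)) 0 0 - (e : SL(2, ℤ)) 1 1 : ℤ)) : ZMod p) = 0) := by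
    rintro ⟨hc, had⟩
    rw [ZMod.intCast_zmod_eq_zero_iff_dvd] at hc had
    apply hdisc
    have : (((e : SL(2, ℤ)) 0 0 + (e : SL(2, ℤ)) 1 1) ^ 2 - 4 : ℤ) =
        ((e : SL(2, ℤ)) 0 0 - (e : SL(2, ℤ)) 1 1) * ((e : SL(2, ℤ)) 0 0 - (e : SL(2, ℤ)) 1 1) +
          4 * (e : SL(2, ℤ)) 0 1 * (e : SL(2, ℤ)) 1 0 := by
      linear_combination (4 : ℤ) * hdet
    rw [this]
    exact dvd_add (dvd_mul_of_dvd_left had _) (dvd_mul_of_dvd_right hc _)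
  by_contra hlt
  rw [not_le, Finset.two_lt_card_iff] at hlt
  obtain ⟨l₁, l₂, l₃, h₁, h₂, h₃, h12, h13, h23⟩ := hlt
  simp only [Finset.mem_filter, Finset.mem_univ, true_and] at h₁ h₂ h₃
  -- at most one of the three is `∞`; extract two (or three) affine fixed cosets
  have key : ∀ (m₁ m₂ m₃ : HeckeIdx L p), heckePerm hp e m₁ = m₁ → heckePerm hp e m₂ = m₂ →
      heckePerm hp e m₃ = m₃ → m₁ ≠ m₂ → m₁ ≠ m₃ → m₂ ≠ m₃ → m₁.1 ≠ none → m₂.1 ≠ none → False := by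
    intro m₁ m₂ m₃ hm₁ hm₂ hm₃ n12 n13 n23 hs₁ hs₂
    obtain ⟨o₁, ho₁⟩ := m₁
    obtain ⟨o₂, ho₂⟩ := m₂
    obtain ⟨o₃, ho₃⟩ := m₃
    obtain ⟨j₁, rfl⟩ := Option.ne_none_iff_exists'.mp hs₁
    obtain ⟨j₂, rfl⟩ := Option.ne_none_iff_exists'.mp hs₂
    have r₁ := zmod_root_of_fixed hp e j₁ ho₁ hm₁
    have r₂ := zmod_root_of_fixed hp e j₂ ho₂ hm₂
    have hj12 : j₁ ≠ j₂ := fun h ↦ n12 (Subtype.ext (congrArg some h))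
    rcases o₃ with _ | j₃
    · -- `∞` fixed: `p ∣ c`, the relation is linear with `ā − d̄ ≠ 0`
      have hc := (ZMod.intCast_zmod_eq_zero_iff_dvd _ p).mpr
        (dvd_apply_one_zero_of_heckePerm_none_eq_self hp e ho₃ hm₃)
      rw [hc, zero_mul, zero_add] at r₁ r₂
      exact hne ⟨hc, linear_two_roots r₁ r₂ hj12⟩
    · have r₃ := zmod_root_of_fixed hp e j₃ ho₃ hm₃
      have hj13 : j₁ ≠ j₃ := fun h ↦ n13 (Subtype.ext (congrArg some h))
      have hj23 : j₂ ≠ j₃ := fun h ↦ n23 (Subtype.ext (congrArg some h))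
      exact hne (quadratic_three_roots r₁ r₂ r₃ hj12 hj13 hj23)
  -- case analysis on which of `l₁, l₂, l₃` is `∞` (at most one, by injectivity of `Subtype.val`)
  by_cases hn₁ : l₁.1 = none
  · have hn₂ : l₂.1 ≠ none := fun h ↦ h12 (Subtype.ext (hn₁.trans h.symm))
    have hn₃ : l₃.1 ≠ none := fun h ↦ h13 (Subtype.ext (hn₁.trans h.symm))
    exact key l₂ l₃ l₁ h₂ h₃ h₁ h23 (Ne.symm h12) (Ne.symm h13) hn₂ hn₃
  · by_cases hn₂ : l₂.1 = none
    · have hn₃ : l₃.1 ≠ none := fun h ↦ h23 (Subtype.ext (hn₂.trans h.symm))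
      exact key l₁ l₃ l₂ h₁ h₃ h₂ h13 h12 (Ne.symm h23) hn₁ hn₃
    · exact key l₁ l₂ l₃ h₁ h₂ h₃ h12 h13 h23 hn₁ hn₂

end FixedCosets

/-! ### The trace identity for elliptic elements: `∑_l Ψ̄(e'_l) = 2Ψ̄(e)` -/

section EllipticTrace

variable (N : ℕ) [NeZero N] (h9 : 3 ^ 2 ∣ N) {p : ℕ} [NeZero p] (hp : p.Prime)

/-- `Ψ̄` is a class function: `Ψ̄(g⁻¹ e g) = Ψ̄(e)`. [cite: Manin1972, §1.5 and Prop. 1.4] -/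
theorem mkQ_liftedSymbol_conj (g e : Gamma0 (N / 3)) :
    (shiftSubOneLattice N h9).mkQ (liftedSymbol N h9 (g⁻¹ * e * g)) =
      (shiftSubOneLattice N h9).mkQ (liftedSymbol N h9 e) := by
  have h1 := mkQ_liftedSymbol_mul N h9 g⁻¹ g
  rw [inv_mul_cancel, liftedSymbol_one, map_zero] at h1
  have h2 : (shiftSubOneLattice N h9).mkQ (liftedSymbol N h9 g⁻¹) =
      -(shiftSubOneLattice N h9).mkQ (liftedSymbol N h9 g) := eq_neg_of_add_eq_zero_left h1.symm
  rw [mkQ_liftedSymbol_mul, mkQ_liftedSymbol_mul, h2]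
  abel

/-- **For an elliptic `e` (`|tr e| ≤ 1`) the trace is carried by the fixed cosets**:
`∑_l Ψ̄(e'_l) = ∑_{σ_e l = l} Ψ̄(e'_l)`, since `e² = −1` or `e³ = ±1` and the orbits of `σ_e` have size `2`,
resp. `3`, or `1`. [cite: Knapp1993, Prop. 11.23 proof (PDF pp. 244–245)] -/
theorem sum_mkQ_liftedSymbol_heckePermElt_eq_sum_filter_fixed_of_abs_trace_le_one (e : Gamma0 (N / 3))
    (he : |(e : SL(2, ℤ)) 0 0 + (e : SL(2, ℤ)) 1 1| ≤ 1) :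
    ∑ l : HeckeIdx (N / 3) p, (shiftSubOneLattice N h9).mkQ (liftedSymbol N h9 (heckePermElt hp e l)) =
      ∑ l ∈ Finset.univ.filter (fun l ↦ heckePerm hp e l = l),
        (shiftSubOneLattice N h9).mkQ (liftedSymbol N h9 (heckePermElt hp e l)) := by
  obtain ⟨hlo, hhi⟩ := abs_le.mp he
  have ht : (e : SL(2, ℤ)) 0 0 + (e : SL(2, ℤ)) 1 1 = 0 ∨ (e : SL(2, ℤ)) 0 0 + (e : SL(2, ℤ)) 1 1 = 1 ∨
      (e : SL(2, ℤ)) 0 0 + (e : SL(2, ℤ)) 1 1 = -1 := by omega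
  rcases ht with ht | ht | ht
  · have h2 : ((e ^ 2 : Gamma0 (N / 3)) : SL(2, ℤ)) = -1 := by
      rw [Subgroup.coe_pow, pow_two]; exact mul_self_eq_neg_one_of_trace_eq_zero ht
    refine sum_mkQ_liftedSymbol_heckePermElt_eq_sum_filter_fixed N h9 hp e Nat.prime_two
      (fun l ↦ heckePerm_eq_self_of_coe_eq_neg_one hp h2 l) ?_
    rw [h2]; simp
  · have h3 : ((e ^ 3 : Gamma0 (N / 3)) : SL(2, ℤ)) = -1 := by
      rw [Subgroup.coe_pow, pow_succ, pow_two]; exact mul_mul_self_eq_neg_one_of_trace_eq_one ht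
    refine sum_mkQ_liftedSymbol_heckePermElt_eq_sum_filter_fixed N h9 hp e Nat.prime_three
      (fun l ↦ heckePerm_eq_self_of_coe_eq_neg_one hp h3 l) ?_
    rw [h3]; simp
  · have h3 : e ^ 3 = 1 := by
      apply Subtype.ext
      rw [Subgroup.coe_pow, pow_succ, pow_two, Subgroup.coe_one]
      exact mul_mul_self_eq_one_of_trace_eq_neg_one ht
    refine sum_mkQ_liftedSymbol_heckePermElt_eq_sum_filter_fixed N h9 hp e Nat.prime_three
      (fun l ↦ by rw [h3]; exact heckePerm_one hp l) ?_
    rw [h3]; simp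

omit [NeZero p] in
include hp in
/-- `p ∤ tr(e)² − 4` for `e` elliptic and `p ≠ 2, 3` (`tr² − 4 ∈ {−3, −4}`) (plumbing). [cite: Shimura1971, §1.3] -/
private theorem not_dvd_disc_of_abs_trace_le_one (hp2 : p ≠ 2) (hp3 : p ≠ 3) {t : ℤ} (ht : |t| ≤ 1) :
    ¬(p : ℤ) ∣ t ^ 2 - 4 := by
  obtain ⟨hlo, hhi⟩ := abs_le.mp ht
  have hcases : t ^ 2 - 4 = -4 ∨ t ^ 2 - 4 = -3 := by
    have : t = 0 ∨ t = 1 ∨ t = -1 := by omega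
    rcases this with rfl | rfl | rfl <;> norm_num
  intro h
  rcases hcases with hc | hc <;> rw [hc, dvd_neg] at h
  · have h4 : p ∣ 2 ^ 2 := by exact_mod_cast h
    exact hp2 ((Nat.prime_dvd_prime_iff_eq hp Nat.prime_two).mp (hp.dvd_of_dvd_pow h4))
  · have h3 : p ∣ 3 := by exact_mod_cast h
    exact hp3 ((Nat.prime_dvd_prime_iff_eq hp Nat.prime_three).mp h3)

include hp in
/-- **Given a norm-`p` element of `ℤ[e]`, the trace of an elliptic `e` is `2Ψ̄(e)`**: the two cosets of
`λ, λ̄` are fixed with `e'_l` conjugate to `e` in `Γ₀(N/3)`, there are no other fixed cosets, and the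
non-trivial orbits contribute `0`. [cite: Knapp1993, Prop. 11.23 proof (PDF pp. 244–245)] [cite: Shimura1971, §1.3 and §8.3 p. 237] -/
theorem sum_mkQ_liftedSymbol_heckePermElt_eq_two_smul_of_norm_eq (hp2 : p ≠ 2) (hp3 : p ≠ 3)
    (hpM : ¬p ∣ N / 3) (e : Gamma0 (N / 3)) (he : |(e : SL(2, ℤ)) 0 0 + (e : SL(2, ℤ)) 1 1| ≤ 1) (u v : ℤ)
    (huv : u ^ 2 + u * v * ((e : SL(2, ℤ)) 0 0 + (e : SL(2, ℤ)) 1 1) + v ^ 2 = p) :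
    ∑ l : HeckeIdx (N / 3) p, (shiftSubOneLattice N h9).mkQ (liftedSymbol N h9 (heckePermElt hp e l)) =
      2 • (shiftSubOneLattice N h9).mkQ (liftedSymbol N h9 e) := by
  classical
  have hdisc := not_dvd_disc_of_abs_trace_le_one hp hp2 hp3 he
  set t := (e : SL(2, ℤ)) 0 0 + (e : SL(2, ℤ)) 1 1 with ht
  have huv' : (u + v * t) ^ 2 + (u + v * t) * (-v) * ((e : SL(2, ℤ)) 0 0 + (e : SL(2, ℤ)) 1 1) + (-v) ^ 2 = p := by
    rw [← huv, ← ht]; ring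
  obtain ⟨l₁, g₁, hσ₁, hh₁, hg₁⟩ := exists_heckePerm_eq_self_of_norm_eq hp e u v huv hpM
  obtain ⟨l₂, g₂, hσ₂, hh₂, hg₂⟩ := exists_heckePerm_eq_self_of_norm_eq hp e (u + v * t) (-v) huv' hpM
  have hne : l₁ ≠ l₂ := heckeIdx_ne_of_norm_eq hp e u v huv hdisc hg₁ hg₂
  have hF : ({l₁, l₂} : Finset (HeckeIdx (N / 3) p)) = Finset.univ.filter (fun l ↦ heckePerm hp e l = l) := by
    refine Finset.eq_of_subset_of_card_le (fun l hl ↦ ?_) ?_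
    · simp only [Finset.mem_insert, Finset.mem_singleton] at hl
      rcases hl with rfl | rfl <;> simpa
    · rw [Finset.card_pair hne]
      exact card_filter_heckePerm_eq_self_le_two hp e hdisc
  rw [sum_mkQ_liftedSymbol_heckePermElt_eq_sum_filter_fixed_of_abs_trace_le_one N h9 hp e he, ← hF,
    Finset.sum_pair hne, hh₁, hh₂, mkQ_liftedSymbol_conj, mkQ_liftedSymbol_conj, two_smul]

include hp in
/-- **The trace identity for elliptic elements.**  For `9 ∣ N`, `p ≡ 1 (mod 3)` a prime with `p ≠ 2` and
`p ∤ N/3`, and `e ∈ Γ₀(N/3)` elliptic (`|tr e| ≤ 1`):  `∑_{l ∈ I_p(N/3)} Ψ(e'_l) − 2Ψ(e) ∈ Λ₁`.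
If `tr e = ±1`, `p = x² + 3y²` (Fermat; `exists_eq_sq_add_three_mul_sq_iff`) gives a norm-`p` element of
`ℤ[e] ≅ ℤ[ω]`; if `tr e = 0`, either `σ_e` has no fixed coset (then both sides vanish, `2Ψ̄(e) = Ψ̄(e²) = Ψ̄(−1) = 0`)
or `−1` is a square mod `p` and `p = u² + v²` (`Nat.Prime.sq_add_sq`).  This is the elliptic half of the
level-`N/3` statement to which `FixedPointSymbolHeckeShift` reduces
(`T_sub_two_smul_symbolInt_mem_shiftSubOneLattice_of`). [cite: Knapp1993, Prop. 11.23 proof (PDF pp. 244–245)]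
[cite: Shimura1971, §1.3 and §8.3 p. 237] -/
theorem sum_liftedSymbol_heckePermElt_sub_two_smul_mem_of_abs_trace_le_one (hp2 : p ≠ 2) (hp1 : p % 3 = 1)
    (hpM : ¬p ∣ N / 3) (e : Gamma0 (N / 3)) (he : |(e : SL(2, ℤ)) 0 0 + (e : SL(2, ℤ)) 1 1| ≤ 1) :
    ∑ l : HeckeIdx (N / 3) p, liftedSymbol N h9 (heckePermElt hp e l) - 2 • liftedSymbol N h9 e ∈
      shiftSubOneLattice N h9 := by
  classical
  haveI : Fact p.Prime := ⟨hp⟩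
  have hp3 : p ≠ 3 := by rintro rfl; simp at hp1
  rw [sum_liftedSymbol_heckePermElt_sub_two_smul_mem_iff]
  obtain ⟨hlo, hhi⟩ := abs_le.mp he
  have ht : (e : SL(2, ℤ)) 0 0 + (e : SL(2, ℤ)) 1 1 = 0 ∨ (e : SL(2, ℤ)) 0 0 + (e : SL(2, ℤ)) 1 1 = 1 ∨
      (e : SL(2, ℤ)) 0 0 + (e : SL(2, ℤ)) 1 1 = -1 := by omega
  -- `p = x² + 3y²`
  obtain ⟨x, y, hxy⟩ :=
    (Literature.NumberTheory.QuadraticFields.Quadratic.exists_eq_sq_add_three_mul_sq_iff hp hp2).mpr (Or.inr hp1)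
  rcases ht with ht | ht | ht
  · -- trace `0`: `ℤ[e] ≅ ℤ[i]`
    by_cases hF : (Finset.univ.filter fun l : HeckeIdx (N / 3) p ↦ heckePerm hp e l = l) = ∅
    · -- no fixed coset: both sides vanish
      rw [sum_mkQ_liftedSymbol_heckePermElt_eq_sum_filter_fixed_of_abs_trace_le_one N h9 hp e he, hF,
        Finset.sum_empty, two_smul, ← mkQ_liftedSymbol_mul, liftedSymbol_eq_zero_of_apply_one_zero N h9, map_zero]
      rw [Subgroup.coe_mul, mul_self_eq_neg_one_of_trace_eq_zero ht]
      simp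
    · obtain ⟨l, hl⟩ := Finset.nonempty_iff_ne_empty.mpr hF
      simp only [Finset.mem_filter, Finset.mem_univ, true_and] at hl
      have hsq := isSquare_of_heckePerm_eq_self hp e l hl
      rw [ht] at hsq
      have hsq1 : IsSquare (-1 : ZMod p) := by
        obtain ⟨r, hr⟩ := hsq
        push_cast at hr
        have h2 : (2 : ZMod p) ≠ 0 := by
          intro h
          have := (ZMod.intCast_zmod_eq_zero_iff_dvd 2 p).mp (by exact_mod_cast h)
          have h22 : p ∣ 2 := by exact_mod_cast this
          exact hp2 ((Nat.prime_dvd_prime_iff_eq hp Nat.prime_two).mp h22)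
        refine ⟨r * (2 : ZMod p)⁻¹, ?_⟩
        field_simp
        linear_combination hr
      obtain ⟨a, b, hab⟩ := Nat.Prime.sq_add_sq (ZMod.exists_sq_eq_neg_one_iff.mp hsq1)
      refine sum_mkQ_liftedSymbol_heckePermElt_eq_two_smul_of_norm_eq N h9 hp hp2 hp3 hpM e he a b ?_
      rw [ht, mul_zero, add_zero]; exact_mod_cast hab
  · refine sum_mkQ_liftedSymbol_heckePermElt_eq_two_smul_of_norm_eq N h9 hp hp2 hp3 hpM e he (x - y) (2 * y) ?_
    rw [ht, hxy]; ring
  · refine sum_mkQ_liftedSymbol_heckePermElt_eq_two_smul_of_norm_eq N h9 hp hp2 hp3 hpM e he (x - y) (-(2 * y)) ?_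
    rw [ht, hxy]; ring

end EllipticTrace

/-! ### Parabolic elements: the unipotent family `u(k; x, z) = 1 + k (x, z)ᵀ(−z, x)` -/

section ParabolicFamily

/-- **The unipotent matrix `u(k; x, z) = 1 + k·(x, z)ᵀ(−z, x) = (1 − kxz, kx²; −kz², 1 + kxz)`**: for
`(x, z)` coprime and `k ≠ 0` the parabolic element of `SL₂(ℤ)` fixing the cusp `x/z`, `= a Tᵏ a⁻¹` for any
`a ∈ SL₂(ℤ)` with `a∞ = x/z`. [cite: Shimura1971, §1.3] -/
def unipMat (k x z : ℤ) : Matrix (Fin 2) (Fin 2) ℤ :=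
  !![1 - k * x * z, k * x ^ 2; -(k * z ^ 2), 1 + k * x * z]

/-- `det u(k; x, z) = 1`. [cite: Shimura1971, §1.3] -/
theorem det_unipMat (k x z : ℤ) : (unipMat k x z).det = 1 := by
  rw [unipMat, Matrix.det_fin_two_of]; ring

/-- `tr u(k; x, z) = 2`. [cite: Shimura1971, §1.3] -/
theorem trace_unipMat (k x z : ℤ) : (unipMat k x z).trace = 2 := by
  rw [unipMat, Matrix.trace_fin_two_of]; ring

/-- `u(k; x, z) u(k'; x, z) = u(k + k'; x, z)` (a one-parameter unipotent group). [cite: Shimura1971, §1.3] -/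
theorem unipMat_mul (k k' x z : ℤ) : unipMat k x z * unipMat k' x z = unipMat (k + k') x z := by
  ext i j
  fin_cases i <;> fin_cases j <;> simp [unipMat, Matrix.mul_apply, Fin.sum_univ_two] <;> ring

/-- **Equivariance `g u(k; v) = u(k; gv) g`** for `g ∈ SL₂(ℤ)` (`g u(k; v) g⁻¹ = u(k; gv)`). [cite: Shimura1971, §1.3] -/
theorem coe_mul_unipMat (g : SL(2, ℤ)) (k x z : ℤ) :
    (g : Matrix (Fin 2) (Fin 2) ℤ) * unipMat k x z =
      unipMat k (g 0 0 * x + g 0 1 * z) (g 1 0 * x + g 1 1 * z) * (g : Matrix (Fin 2) (Fin 2) ℤ) := by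
  have hdet := g.det_coe
  rw [Matrix.det_fin_two] at hdet
  ext i j
  fin_cases i <;> fin_cases j <;> simp [unipMat, Matrix.mul_apply, Fin.sum_univ_two]
  · linear_combination (k * (g 0 0 * x + g 0 1 * z) * z) * hdet
  · linear_combination (-(k * (g 0 0 * x + g 0 1 * z) * x)) * hdet
  · linear_combination (k * (g 1 0 * x + g 1 1 * z) * z) * hdet
  · linear_combination (-(k * (g 1 0 * x + g 1 1 * z) * x)) * hdet

/-- `u(k; x, z)` as an element of `SL₂(ℤ)`. [cite: Shimura1971, §1.3] -/
def unipSL (k x z : ℤ) : SL(2, ℤ) := ⟨unipMat k x z, det_unipMat k x z⟩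

/-- The matrix of `unipSL`. [cite: Shimura1971, §1.3] -/
@[simp] theorem coe_unipSL (k x z : ℤ) : ((unipSL k x z : SL(2, ℤ)) : Matrix (Fin 2) (Fin 2) ℤ) = unipMat k x z := rfl

/-- `u(k; x, z) ∈ Γ₀(M)` iff `M ∣ kz²` (the `if` direction). [cite: Shimura1971, §1.3] -/
theorem unipSL_mem_Gamma0 {M : ℕ} {k x z : ℤ} (h : (M : ℤ) ∣ k * z ^ 2) : unipSL k x z ∈ Gamma0 M := by
  rw [Gamma0_mem]
  change ((((unipMat k x z) 1 0 : ℤ)) : ZMod M) = 0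
  simp only [unipMat, Matrix.of_apply, Matrix.cons_val', Matrix.cons_val_zero, Matrix.cons_val_one,
    Matrix.cons_val_fin_one]
  exact (ZMod.intCast_zmod_eq_zero_iff_dvd _ M).mpr (dvd_neg.mpr h)

/-- **The parabolic element `u(k; x, z) ∈ Γ₀(M)`** (`M ∣ kz²`). [cite: Shimura1971, §1.3] -/
def parabElt (M : ℕ) (k x z : ℤ) (h : (M : ℤ) ∣ k * z ^ 2) : Gamma0 M :=
  ⟨unipSL k x z, unipSL_mem_Gamma0 h⟩

/-- The matrix of `parabElt`. [cite: Shimura1971, §1.3] -/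
@[simp] theorem coe_parabElt (M : ℕ) (k x z : ℤ) (h : (M : ℤ) ∣ k * z ^ 2) :
    ((parabElt M k x z h : Gamma0 M) : SL(2, ℤ)) = unipSL k x z := rfl

/-- Two elements of `Γ₀(L)` with the same matrix are equal (plumbing). [folklore] -/
private theorem gamma0_eq_of_coe_eq {L : ℕ} {γ δ : Gamma0 L}
    (h : ((γ : SL(2, ℤ)) : Matrix (Fin 2) (Fin 2) ℤ) = ((δ : SL(2, ℤ)) : Matrix (Fin 2) (Fin 2) ℤ)) : γ = δ :=
  Subtype.ext (Matrix.SpecialLinearGroup.ext _ _ fun i j ↦ congrFun (congrFun h i) j)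

/-- `M ∣ (k + k') z²` (plumbing). [folklore] -/
private theorem dvd_add_mul_sq {M : ℕ} {k k' z : ℤ} (h : (M : ℤ) ∣ k * z ^ 2) (h' : (M : ℤ) ∣ k' * z ^ 2) :
    (M : ℤ) ∣ (k + k') * z ^ 2 := by
  rw [add_mul]; exact dvd_add h h'

/-- `u(k) u(k') = u(k + k')` in `Γ₀(M)`. [cite: Shimura1971, §1.3] -/
theorem parabElt_mul (M : ℕ) (k k' x z : ℤ) (h : (M : ℤ) ∣ k * z ^ 2) (h' : (M : ℤ) ∣ k' * z ^ 2) :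
    parabElt M k x z h * parabElt M k' x z h' = parabElt M (k + k') x z (dvd_add_mul_sq h h') :=
  gamma0_eq_of_coe_eq (by simp [unipMat_mul])

/-- `M ∣ (n k) z²` (plumbing). [folklore] -/
private theorem dvd_mul_mul_sq {M : ℕ} {k z : ℤ} (n : ℤ) (h : (M : ℤ) ∣ k * z ^ 2) : (M : ℤ) ∣ n * k * z ^ 2 := by
  rw [mul_assoc]; exact Dvd.dvd.mul_left h n

/-- `u(k)ⁿ = u(nk)` in `Γ₀(M)`. [cite: Shimura1971, §1.3] -/
theorem parabElt_pow (M : ℕ) (k x z : ℤ) (h : (M : ℤ) ∣ k * z ^ 2) (n : ℕ) :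
    parabElt M k x z h ^ n = parabElt M (n * k) x z (dvd_mul_mul_sq n h) := by
  induction n with
  | zero =>
    apply gamma0_eq_of_coe_eq
    simp only [pow_zero, Subgroup.coe_one, Matrix.SpecialLinearGroup.coe_one, coe_parabElt, coe_unipSL]
    ext i j
    fin_cases i <;> fin_cases j <;> simp [unipMat]
  | succ n ih =>
    rw [pow_succ, ih, parabElt_mul]
    apply gamma0_eq_of_coe_eq
    simp only [coe_parabElt, coe_unipSL]
    push_cast
    ring_nf

/-- **`g u(k; v) g⁻¹ = u(k; gv)` in `Γ₀(M)`**: conjugation moves the cusp. [cite: Shimura1971, §1.3] -/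
theorem mul_parabElt_mul_inv {M : ℕ} (g : Gamma0 M) (k x z : ℤ) (h : (M : ℤ) ∣ k * z ^ 2)
    (h' : (M : ℤ) ∣ k * ((g : SL(2, ℤ)) 1 0 * x + (g : SL(2, ℤ)) 1 1 * z) ^ 2) :
    g * parabElt M k x z h * g⁻¹ =
      parabElt M k ((g : SL(2, ℤ)) 0 0 * x + (g : SL(2, ℤ)) 0 1 * z) ((g : SL(2, ℤ)) 1 0 * x + (g : SL(2, ℤ)) 1 1 * z) h' := by
  rw [mul_inv_eq_iff_eq_mul]
  apply gamma0_eq_of_coe_eq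
  simp only [Subgroup.coe_mul, Matrix.SpecialLinearGroup.coe_mul, coe_parabElt, coe_unipSL]
  exact coe_mul_unipMat (g : SL(2, ℤ)) k x z

/-- `M ∣ k (γx + δz)²` for `(α β; γ δ) ∈ Γ₀(M)` and `M ∣ kz²` (plumbing). [folklore] -/
private theorem dvd_mul_sq_of_mem {M : ℕ} (g : Gamma0 M) {k x z : ℤ} (h : (M : ℤ) ∣ k * z ^ 2) :
    (M : ℤ) ∣ k * ((g : SL(2, ℤ)) 1 0 * x + (g : SL(2, ℤ)) 1 1 * z) ^ 2 := by
  obtain ⟨-, ⟨c', hc'⟩, -⟩ := coe_mem_delta0_one g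
  obtain ⟨w, hw⟩ := h
  refine ⟨k * (M : ℤ) * c' ^ 2 * x ^ 2 + 2 * k * c' * x * (g : SL(2, ℤ)) 1 1 * z + w * (g : SL(2, ℤ)) 1 1 ^ 2, ?_⟩
  have hc'' : (g : SL(2, ℤ)) 1 0 = (M : ℤ) * c' := hc'
  rw [hc'']
  linear_combination (g : SL(2, ℤ)) 1 1 ^ 2 * hw

end ParabolicFamily

section ParabolicSymbol

variable (N : ℕ) [NeZero N] (h9 : 3 ^ 2 ∣ N)

/-- `Ψ̄(u(k + k')) = Ψ̄(u(k)) + Ψ̄(u(k'))`. [cite: Manin1972, §1.5 and Prop. 1.4] -/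
theorem mkQ_liftedSymbol_parabElt_add (k k' x z : ℤ) (h : ((N / 3 : ℕ) : ℤ) ∣ k * z ^ 2)
    (h' : ((N / 3 : ℕ) : ℤ) ∣ k' * z ^ 2) :
    (shiftSubOneLattice N h9).mkQ (liftedSymbol N h9 (parabElt (N / 3) (k + k') x z (dvd_add_mul_sq h h'))) =
      (shiftSubOneLattice N h9).mkQ (liftedSymbol N h9 (parabElt (N / 3) k x z h)) +
        (shiftSubOneLattice N h9).mkQ (liftedSymbol N h9 (parabElt (N / 3) k' x z h')) := by
  rw [← parabElt_mul, mkQ_liftedSymbol_mul]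

/-- `Ψ̄(u(k; gv)) = Ψ̄(u(k; v))` for `g ∈ Γ₀(N/3)` (class function). [cite: Manin1972, §1.5 and Prop. 1.4] -/
theorem mkQ_liftedSymbol_parabElt_smul (g : Gamma0 (N / 3)) (k x z : ℤ) (h : ((N / 3 : ℕ) : ℤ) ∣ k * z ^ 2)
    (h' : ((N / 3 : ℕ) : ℤ) ∣ k * ((g : SL(2, ℤ)) 1 0 * x + (g : SL(2, ℤ)) 1 1 * z) ^ 2) :
    (shiftSubOneLattice N h9).mkQ (liftedSymbol N h9
      (parabElt (N / 3) k ((g : SL(2, ℤ)) 0 0 * x + (g : SL(2, ℤ)) 0 1 * z) ((g : SL(2, ℤ)) 1 0 * x + (g : SL(2, ℤ)) 1 1 * z) h')) =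
      (shiftSubOneLattice N h9).mkQ (liftedSymbol N h9 (parabElt (N / 3) k x z h)) := by
  rw [← mul_parabElt_mul_inv g k x z h h']
  have := mkQ_liftedSymbol_conj N h9 g⁻¹ (parabElt (N / 3) k x z h)
  rwa [inv_inv] at this

/-- `N ∣ k (3z)²` when `N/3 ∣ k z²` (`9 ∣ N`) (plumbing). [folklore] -/
private theorem dvd_mul_three_mul_sq {L : ℕ} (h9' : 3 ^ 2 ∣ L) {k z : ℤ} (h : ((L / 3 : ℕ) : ℤ) ∣ k * z ^ 2) :
    (L : ℤ) ∣ k * (3 * z) ^ 2 := by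
  have hN : (L : ℤ) = 3 * ((L / 3 : ℕ) : ℤ) := by
    have := Nat.div_mul_cancel ((dvd_pow_self 3 two_ne_zero).trans h9')
    exact_mod_cast (by rw [mul_comm] at this; exact this.symm)
  rw [hN, show k * (3 * z) ^ 2 = 3 * (k * z ^ 2) * 3 by ring]
  exact Dvd.dvd.mul_right (mul_dvd_mul_left 3 h) 3

/-- **`Ψ(u(3k; x, z)) = 0`**: `u(3k; x, z) = diag(3,1) u(k; x, 3z) diag(3,1)⁻¹` with `u(k; x, 3z) ∈ Γ₀(N)`
parabolic, and the modular symbol `{∞, γ∞}` of a parabolic `γ ∈ Γ₀(N)` vanishes (Knapp Prop. 11.1).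
[cite: Knapp1993, Prop. 11.1] -/
theorem liftedSymbol_parabElt_three_mul (k x z : ℤ) (h : ((N / 3 : ℕ) : ℤ) ∣ k * z ^ 2)
    (h3 : ((N / 3 : ℕ) : ℤ) ∣ 3 * k * z ^ 2) :
    liftedSymbol N h9 (parabElt (N / 3) (3 * k) x z h3) = 0 := by
  have hγ : Gamma0.degeneracyConj (N / 3) N 3 (div_three_mul_three_dvd' h9)
      (parabElt N k x (3 * z) (dvd_mul_three_mul_sq h9 h)) = parabElt (N / 3) (3 * k) x z h3 := by
    apply gamma0_eq_of_coe_eq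
    ext i j
    fin_cases i <;> fin_cases j <;>
      simp [Gamma0.degeneracyConj_apply, Gamma0.degeneracyConjElt_apply_zero_zero,
        Gamma0.degeneracyConjElt_apply_zero_one, Gamma0.degeneracyConjElt_apply_one_zero,
        Gamma0.degeneracyConjElt_apply_one_one, unipMat]
    · ring
    · ring
    · rw [show -(k * (3 * z) ^ 2) = 3 * (-(3 * k * z ^ 2)) by ring, Int.mul_ediv_cancel_left _ (by norm_num : (3 : ℤ) ≠ 0)]
    · ring
  rw [← hγ, liftedSymbol_degeneracyConj]
  apply Subtype.ext
  ext f
  rw [symbolInt_apply]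
  refine cuspSymbol_eq_zero_of_discr_eq_zero f ?_
  rw [Matrix.discr_fin_two, Matrix.SpecialLinearGroup.det_coe, coe_parabElt, coe_unipSL, trace_unipMat]
  norm_num

/-- **`3Ψ̄(u(k; x, z)) = 0`**: the lifted symbol of a parabolic element of `Γ₀(N/3)` is `3`-torsion in
`Λ_N/Λ₁` (`u³ = u(3k) ∈ diag(3,1)Γ₀(N)diag(3,1)⁻¹` has `Ψ = 0`). [cite: Knapp1993, Prop. 11.1] -/
theorem three_nsmul_mkQ_liftedSymbol_parabElt (k x z : ℤ) (h : ((N / 3 : ℕ) : ℤ) ∣ k * z ^ 2) :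
    3 • (shiftSubOneLattice N h9).mkQ (liftedSymbol N h9 (parabElt (N / 3) k x z h)) = 0 := by
  have h2 := mkQ_liftedSymbol_parabElt_add N h9 k k x z h h
  have h3 := mkQ_liftedSymbol_parabElt_add N h9 (k + k) k x z (dvd_add_mul_sq h h) h
  rw [h2] at h3
  have e : parabElt (N / 3) (k + k + k) x z (dvd_add_mul_sq (dvd_add_mul_sq h h) h) =
      parabElt (N / 3) (3 * k) x z (by simpa [mul_assoc] using dvd_mul_mul_sq 3 h) :=
    gamma0_eq_of_coe_eq (by simp; ring_nf)
  rw [e, liftedSymbol_parabElt_three_mul N h9 k x z h, map_zero] at h3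
  rw [succ_nsmul, two_nsmul]
  exact h3.symm

/-- **`Ψ̄(u(qk)) = Ψ̄(u(k))` for `q ≡ 1 (mod 3)`** (e.g. `q = p`, `p²`): `u(qk) = u(k) · u(3·((q−1)/3)k)`.
[cite: Knapp1993, Prop. 11.1] -/
theorem mkQ_liftedSymbol_parabElt_mul_of_mod_three {q : ℤ} (hq : 3 ∣ q - 1) (k x z : ℤ)
    (h : ((N / 3 : ℕ) : ℤ) ∣ k * z ^ 2) :
    (shiftSubOneLattice N h9).mkQ (liftedSymbol N h9 (parabElt (N / 3) (q * k) x z (dvd_mul_mul_sq q h))) =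
      (shiftSubOneLattice N h9).mkQ (liftedSymbol N h9 (parabElt (N / 3) k x z h)) := by
  obtain ⟨r, hr⟩ := hq
  have hrk : ((N / 3 : ℕ) : ℤ) ∣ r * k * z ^ 2 := dvd_mul_mul_sq r h
  have h3rk : ((N / 3 : ℕ) : ℤ) ∣ 3 * (r * k) * z ^ 2 := by simpa [mul_assoc] using dvd_mul_mul_sq 3 hrk
  have e : parabElt (N / 3) (q * k) x z (dvd_mul_mul_sq q h) =
      parabElt (N / 3) (k + 3 * (r * k)) x z (dvd_add_mul_sq h h3rk) :=
    gamma0_eq_of_coe_eq (by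
      simp only [coe_parabElt, coe_unipSL]
      rw [show q = 1 + 3 * r by linear_combination hr]
      ring_nf)
  rw [e, mkQ_liftedSymbol_parabElt_add N h9 k (3 * (r * k)) x z h h3rk, liftedSymbol_parabElt_three_mul N h9 _ x z hrk,
    map_zero, add_zero]

/-- **`Ψ̄(u(k; x + jz, z)) = Ψ̄(u(k; x, z))`** (`T`-conjugation: `Tʲ u(k; x, z) T⁻ʲ = u(k; x + jz, z)`).
[cite: Manin1972, §1.5 and Prop. 1.4] -/
theorem mkQ_liftedSymbol_parabElt_add_mul (j k x z : ℤ) (h : ((N / 3 : ℕ) : ℤ) ∣ k * z ^ 2) :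
    (shiftSubOneLattice N h9).mkQ (liftedSymbol N h9 (parabElt (N / 3) k (x + j * z) z h)) =
      (shiftSubOneLattice N h9).mkQ (liftedSymbol N h9 (parabElt (N / 3) k x z h)) := by
  -- `g = Tʲ ∈ Γ₀(N/3)`: `g (x, z) = (x + jz, z)`
  set g : Gamma0 (N / 3) := ⟨ModularGroup.T ^ j, by
    rw [Gamma0_mem, ModularGroup.coe_T_zpow]; simp⟩ with hg
  have h00 : (g : SL(2, ℤ)) 0 0 = 1 := by rw [hg]; simp [ModularGroup.coe_T_zpow]
  have h01 : (g : SL(2, ℤ)) 0 1 = j := by rw [hg]; simp [ModularGroup.coe_T_zpow]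
  have h10 : (g : SL(2, ℤ)) 1 0 = 0 := by rw [hg]; simp [ModularGroup.coe_T_zpow]
  have h11 : (g : SL(2, ℤ)) 1 1 = 1 := by rw [hg]; simp [ModularGroup.coe_T_zpow]
  have h' : ((N / 3 : ℕ) : ℤ) ∣ k * ((g : SL(2, ℤ)) 1 0 * x + (g : SL(2, ℤ)) 1 1 * z) ^ 2 := by
    rw [h10, h11, zero_mul, one_mul, zero_add]; exact h
  have := mkQ_liftedSymbol_parabElt_smul N h9 g k x z h h'
  simp only [h00, h01, h10, h11, one_mul, zero_mul, zero_add] at this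
  exact this

end ParabolicSymbol

/-! ### Transport of cusps `x/z ↦ px/z`, `x/(pz)` inside `Γ₀(M)` for `p ≡ 1 (mod M)` -/

section Transport

variable {M : ℕ} {p : ℕ}

/-- **For `p ≡ 1 (mod M)` and `p ∤ z`, the primitive vectors `(x, z)` and `(px, z)` are `Γ₀(M)`-equivalent**:
there is `g ∈ Γ₀(M)` with `g(x, z)ᵀ = (px, z)ᵀ` (explicitly `g = (p − Mqaz, Mqax; Mqbz, 1 − Mqbx)` with
`p − 1 = Mq`, `az + bpx = 1`).  (The cusps `x/z` and `px/z` of `X₀(M)` coincide: `T_p` fixes the cusps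
when `p ≡ 1 (mod M)`.) [cite: Shimura1971, §1.3 and Prop. 1.43] -/
theorem exists_gamma0_vec_eq_mul_fst (hq : (M : ℤ) ∣ (p : ℤ) - 1) (x z : ℤ) (hxz : IsCoprime x z)
    (hpz : IsCoprime (p : ℤ) z) :
    ∃ g : Gamma0 M, (g : SL(2, ℤ)) 0 0 * x + (g : SL(2, ℤ)) 0 1 * z = p * x ∧
      (g : SL(2, ℤ)) 1 0 * x + (g : SL(2, ℤ)) 1 1 * z = z := by
  obtain ⟨q, hq⟩ := hq
  obtain ⟨a, b, hab⟩ : IsCoprime z ((p : ℤ) * x) := (hpz.symm).mul_right hxz.symm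
  refine ⟨⟨⟨!![(p : ℤ) - M * q * a * z, M * q * a * x; M * q * b * z, 1 - M * q * b * x], ?_⟩, ?_⟩, ?_, ?_⟩
  · rw [Matrix.det_fin_two_of]
    linear_combination (-(M : ℤ) * q) * hab + hq
  · rw [Gamma0_mem]
    change ((((M : ℤ) * q * b * z : ℤ)) : ZMod M) = 0
    push_cast
    simp
  · change ((p : ℤ) - M * q * a * z) * x + M * q * a * x * z = p * x
    ring
  · change (M : ℤ) * q * b * z * x + (1 - M * q * b * x) * z = z
    ring

/-- **For `p ≡ 1 (mod M)` and `p ∤ x`, `(x, z)` and `(x, pz)` are `Γ₀(M)`-equivalent**: there is `g ∈ Γ₀(M)` with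
`g(x, z)ᵀ = (x, pz)ᵀ` (explicitly `g = (1 − Mqbz, Mqbx; Mqaz, p − Mqax)` with `p − 1 = Mq`, `ax + bpz = 1`).
[cite: Shimura1971, §1.3 and Prop. 1.43] -/
theorem exists_gamma0_vec_eq_mul_snd (hq : (M : ℤ) ∣ (p : ℤ) - 1) (x z : ℤ) (hxz : IsCoprime x z)
    (hpx : IsCoprime (p : ℤ) x) :
    ∃ g : Gamma0 M, (g : SL(2, ℤ)) 0 0 * x + (g : SL(2, ℤ)) 0 1 * z = x ∧
      (g : SL(2, ℤ)) 1 0 * x + (g : SL(2, ℤ)) 1 1 * z = p * z := by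
  obtain ⟨q, hq⟩ := hq
  obtain ⟨a, b, hab⟩ : IsCoprime x ((p : ℤ) * z) := (hpx.symm).mul_right hxz
  refine ⟨⟨⟨!![1 - M * q * b * z, M * q * b * x; M * q * a * z, (p : ℤ) - M * q * a * x], ?_⟩, ?_⟩, ?_, ?_⟩
  · rw [Matrix.det_fin_two_of]
    linear_combination (-(M : ℤ) * q) * hab + hq
  · rw [Gamma0_mem]
    change ((((M : ℤ) * q * a * z : ℤ)) : ZMod M) = 0
    push_cast
    simp
  · change (1 - (M : ℤ) * q * b * z) * x + M * q * b * x * z = x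
    ring
  · change (M : ℤ) * q * a * z * x + ((p : ℤ) - M * q * a * x) * z = p * z
    ring

end Transport

/-! ### A permutation of prime order with a fixed point on `m + 1` letters -/

section PermOrbits2

/-- **No repetitions in the orbit of a moved point** (`σᵐ = 1`, `m` prime): `σⁱ l = σʲ l` with `i, j < m`
forces `i = j`. [cite: Knapp1993, Prop. 11.23 proof (PDF pp. 244–245)] -/
theorem pow_apply_injOn_of_pow_prime_eq_one {ι : Type*} (σ : Equiv.Perm ι) {m : ℕ} (hm : m.Prime)
    (hσ : σ ^ m = 1) {l : ι} (hl : σ l ≠ l) :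
    ∀ i ∈ Finset.range m, ∀ j ∈ Finset.range m, (fun k ↦ (σ ^ k) l) i = (fun k ↦ (σ ^ k) l) j → i = j := by
  have hpowmod : ∀ e : ℕ, σ ^ (e % m) = σ ^ e := fun e ↦ by
    conv_rhs => rw [← Nat.mod_add_div e m, pow_add, pow_mul, hσ, one_pow, mul_one]
  have hmoved : ∀ i : ℕ, σ ((σ ^ i) l) ≠ (σ ^ i) l := fun i h ↦ by
    rw [← Equiv.Perm.mul_apply, ← pow_succ', pow_succ, Equiv.Perm.mul_apply] at h
    exact hl ((σ ^ i).injective h)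
  have aux : ∀ i j : ℕ, j < m → (σ ^ i) l = (σ ^ j) l → i < j → False := by
    intro i j hj hij hlt
    set d := j - i with hd
    have hd0 : 0 < d := Nat.sub_pos_of_lt hlt
    have hdm : d < m := lt_of_le_of_lt (Nat.sub_le j i) hj
    have hfix : (σ ^ d) ((σ ^ i) l) = (σ ^ i) l := by
      rw [← Equiv.Perm.mul_apply, ← pow_add, hd, Nat.sub_add_cancel hlt.le, ← hij]
    have hcop : Nat.Coprime d m :=
      Nat.coprime_comm.mp ((Nat.Prime.coprime_iff_not_dvd hm).mpr fun h ↦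
        absurd (Nat.le_of_dvd hd0 h) (not_le.mpr hdm))
    obtain ⟨a, -, ha⟩ := Nat.exists_mul_mod_eq_one_of_coprime hcop hm.one_lt
    have hσda : σ ^ (d * a) = σ := by rw [← hpowmod, ha, pow_one]
    have hfix1 : σ ((σ ^ i) l) = (σ ^ i) l := by
      have h := Equiv.Perm.pow_apply_eq_self_of_apply_eq_self hfix a
      rwa [← pow_mul, hσda] at h
    exact hmoved i hfix1
  intro i hi j hj hij
  simp only [Finset.mem_range] at hi hj hij
  by_contra hne
  rcases lt_or_gt_of_ne hne with hlt | hlt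
  · exact aux i j hj hij hlt
  · exact aux j i hi hij.symm hlt

/-- **Orbit decomposition with one fixed point.**  If `σᵐ = 1` (`m` prime) acts on `m + 1` letters, fixing
`l₀` and moving `l₁`, then the letters are `l₀` and the `m` distinct points `σᵏ l₁`, `k < m`, so
`∑_l f(l) = f(l₀) + ∑_{k<m} f(σᵏ l₁)`.  (The shape of `σ_e` on `I_p = ℙ¹(𝔽_p)` for `e` parabolic with
`e ≢ 1 (mod p)`: a transvection.) [cite: Knapp1993, Prop. 11.23 proof (PDF pp. 244–245)] -/
theorem sum_eq_add_sum_range_of_pow_prime_eq_one {ι A : Type*} [Fintype ι] [DecidableEq ι] [AddCommMonoid A]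
    (σ : Equiv.Perm ι) {m : ℕ} (hm : m.Prime) (hσ : σ ^ m = 1) (hcard : Fintype.card ι = m + 1)
    {l₀ l₁ : ι} (h₀ : σ l₀ = l₀) (h₁ : σ l₁ ≠ l₁) (f : ι → A) :
    ∑ l, f l = f l₀ + ∑ k ∈ Finset.range m, f ((σ ^ k) l₁) := by
  classical
  have hinj := pow_apply_injOn_of_pow_prime_eq_one σ hm hσ h₁
  set O : Finset ι := (Finset.range m).image fun k ↦ (σ ^ k) l₁ with hO
  have hOcard : O.card = m := by rw [hO, Finset.card_image_of_injOn (fun i hi j hj h ↦ hinj i hi j hj h), Finset.card_range]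
  have hl₀ : l₀ ∉ O := by
    intro h
    obtain ⟨k, -, hk⟩ := Finset.mem_image.mp h
    have : σ ((σ ^ k) l₁) = (σ ^ k) l₁ := by rw [hk, h₀]
    rw [← Equiv.Perm.mul_apply, ← pow_succ', pow_succ, Equiv.Perm.mul_apply] at this
    exact h₁ ((σ ^ k).injective this)
  have huniv : insert l₀ O = Finset.univ :=
    Finset.eq_univ_of_card _ (by rw [Finset.card_insert_of_notMem hl₀, hOcard, hcard])
  rw [← huniv, Finset.sum_insert hl₀, hO, Finset.sum_image hinj]

end PermOrbits2

/-! ### The cosets of `σ_e` for `e = u(k; x, z)` parabolic -/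

section ParabolicCosets

variable {L : ℕ} {p : ℕ} (hp : p.Prime)
include hp

/-- **Reading off `σ_g(l)` and `g'_l` from one relation**: if `δ β_{l'} = β_l g` with `δ ∈ Γ₀(L)` then
`σ_g(l) = l'` and `g'_l = δ` (uniqueness of the coset). [cite: Shimura1971, §8.3 p. 237] -/
theorem heckePerm_eq_of_rel (g δ : Gamma0 L) (l l' : HeckeIdx L p)
    (h : ((δ : SL(2, ℤ)) : Matrix (Fin 2) (Fin 2) ℤ) * heckeRep p l'.1 =
      heckeRep p l.1 * ((g : SL(2, ℤ)) : Matrix (Fin 2) (Fin 2) ℤ)) :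
    heckePerm hp g l = l' ∧ heckePermElt hp g l = δ := by
  have hσ : heckePerm hp g l = l' :=
    (existsUnique_heckeRep_mul_coe hp g l).unique
      ⟨_, coe_mem_delta0_one _, heckePermElt_spec hp g l⟩ ⟨_, coe_mem_delta0_one δ, h⟩
  refine ⟨hσ, ?_⟩
  have h1 := heckePermElt_spec hp g l
  rw [hσ, ← h] at h1
  have h2 := matrix_mul_right_cancel_of_det_ne_zero (det_heckeRep_ne_zero hp.ne_zero _) h1
  exact Subtype.ext (Matrix.SpecialLinearGroup.ext _ _ fun i j ↦ congrFun (congrFun h2 i) j)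

/-- **`σ_{u(pk; x, z)}` fixes every affine coset**, with `u(pk; x, z)'_j = u(k; x + jz, pz)`
(`βⱼ u(pk; x, z) βⱼ⁻¹ = u(k; x + jz, pz)`). [cite: Shimura1971, §1.3 and §8.3 p. 237] -/
theorem heckePerm_parabElt_mul_some (k x z : ℤ) (hK : (L : ℤ) ∣ (p : ℤ) * k * z ^ 2) (j : ZMod p)
    (hj : (some j : Option (ZMod p)) = none → ¬p ∣ L)
    (h' : (L : ℤ) ∣ k * ((p : ℤ) * z) ^ 2) :
    heckePerm hp (parabElt L ((p : ℤ) * k) x z hK) ⟨some j, hj⟩ = ⟨some j, hj⟩ ∧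
      heckePermElt hp (parabElt L ((p : ℤ) * k) x z hK) ⟨some j, hj⟩ =
        parabElt L k (x + (j.val : ℤ) * z) ((p : ℤ) * z) h' := by
  refine heckePerm_eq_of_rel hp _ _ _ _ ?_
  simp only [coe_parabElt, coe_unipSL, heckeRep]
  ext i j'
  fin_cases i <;> fin_cases j' <;>
    simp only [unipMat, Matrix.mul_apply, Fin.sum_univ_two, Fin.isValue, Fin.zero_eta, Fin.mk_one, Matrix.of_apply,
      Matrix.cons_val', Matrix.cons_val_zero, Matrix.cons_val_one, Matrix.cons_val_fin_one] <;> ring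

/-- **`σ_{u(pk; x, z)}` fixes `∞`**, with `u(pk; x, z)'_∞ = u(k; px, z)` (`β_∞ u(pk; x, z) β_∞⁻¹ = u(k; px, z)`).
[cite: Shimura1971, §1.3 and §8.3 p. 237] -/
theorem heckePerm_parabElt_mul_none (k x z : ℤ) (hK : (L : ℤ) ∣ (p : ℤ) * k * z ^ 2)
    (hn : (none : Option (ZMod p)) = none → ¬p ∣ L) (h' : (L : ℤ) ∣ k * z ^ 2) :
    heckePerm hp (parabElt L ((p : ℤ) * k) x z hK) ⟨none, hn⟩ = ⟨none, hn⟩ ∧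
      heckePermElt hp (parabElt L ((p : ℤ) * k) x z hK) ⟨none, hn⟩ = parabElt L k ((p : ℤ) * x) z h' := by
  refine heckePerm_eq_of_rel hp _ _ _ _ ?_
  simp only [coe_parabElt, coe_unipSL, heckeRep]
  ext i j'
  fin_cases i <;> fin_cases j' <;>
    simp only [unipMat, Matrix.mul_apply, Fin.sum_univ_two, Fin.isValue, Fin.zero_eta, Fin.mk_one, Matrix.of_apply,
      Matrix.cons_val', Matrix.cons_val_zero, Matrix.cons_val_one, Matrix.cons_val_fin_one] <;> ring

/-- **The fixed affine coset of `u(k; x, z)` (`p ∤ z`)**: for `j₀ ≡ −x/z (mod p)`, `x + j₀z = p y₀`,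
`σ(j₀) = j₀` and `u(k; x, z)'_{j₀} = u(kp; y₀, z)`. [cite: Shimura1971, §1.3 and §8.3 p. 237] -/
theorem heckePerm_parabElt_some_fixed (k x z : ℤ) (h : (L : ℤ) ∣ k * z ^ 2) (j₀ : ZMod p)
    (hj : (some j₀ : Option (ZMod p)) = none → ¬p ∣ L) (y₀ : ℤ) (hy : x + (j₀.val : ℤ) * z = p * y₀)
    (h' : (L : ℤ) ∣ k * (p : ℤ) * z ^ 2) :
    heckePerm hp (parabElt L k x z h) ⟨some j₀, hj⟩ = ⟨some j₀, hj⟩ ∧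
      heckePermElt hp (parabElt L k x z h) ⟨some j₀, hj⟩ = parabElt L (k * (p : ℤ)) y₀ z h' := by
  refine heckePerm_eq_of_rel hp _ _ _ _ ?_
  simp only [coe_parabElt, coe_unipSL, heckeRep]
  ext i j'
  fin_cases i <;> fin_cases j' <;>
    simp only [unipMat, Matrix.mul_apply, Fin.sum_univ_two, Fin.isValue, Fin.zero_eta, Fin.mk_one, Matrix.of_apply,
      Matrix.cons_val', Matrix.cons_val_zero, Matrix.cons_val_one, Matrix.cons_val_fin_one]
  · linear_combination k * z * hy
  · linear_combination (-(k * (x + p * y₀))) * hy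
  · ring
  · linear_combination (-(k * p * z)) * hy

/-- **The fixed coset `∞` of `u(k; x, pz₁)`**: `σ(∞) = ∞` and `u(k; x, pz₁)'_∞ = u(kp; x, z₁)`.
[cite: Shimura1971, §1.3 and §8.3 p. 237] -/
theorem heckePerm_parabElt_none_fixed (k x z₁ : ℤ) (h : (L : ℤ) ∣ k * ((p : ℤ) * z₁) ^ 2)
    (hn : (none : Option (ZMod p)) = none → ¬p ∣ L) (h' : (L : ℤ) ∣ k * (p : ℤ) * z₁ ^ 2) :
    heckePerm hp (parabElt L k x ((p : ℤ) * z₁) h) ⟨none, hn⟩ = ⟨none, hn⟩ ∧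
      heckePermElt hp (parabElt L k x ((p : ℤ) * z₁) h) ⟨none, hn⟩ = parabElt L (k * (p : ℤ)) x z₁ h' := by
  refine heckePerm_eq_of_rel hp _ _ _ _ ?_
  simp only [coe_parabElt, coe_unipSL, heckeRep]
  ext i j'
  fin_cases i <;> fin_cases j' <;>
    simp only [unipMat, Matrix.mul_apply, Fin.sum_univ_two, Fin.isValue, Fin.zero_eta, Fin.mk_one, Matrix.of_apply,
      Matrix.cons_val', Matrix.cons_val_zero, Matrix.cons_val_one, Matrix.cons_val_fin_one] <;> ring

end ParabolicCosets

/-! ### The trace identity for parabolic elements: `∑_l Ψ̄(e'_l) = 2Ψ̄(e)` -/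

section ParabolicTrace

variable (N : ℕ) [NeZero N] (h9 : 3 ^ 2 ∣ N) {p : ℕ} [NeZero p] (hp : p.Prime)

/-- `u(k; x, z) = u(k'; x', z')` from the three products (plumbing). [folklore] -/
private theorem parabElt_eq_of {M : ℕ} {k x z : ℤ} (h : (M : ℤ) ∣ k * z ^ 2) (k' x' z' : ℤ)
    (h' : (M : ℤ) ∣ k' * z' ^ 2) (h1 : k * x * z = k' * x' * z') (h2 : k * x ^ 2 = k' * x' ^ 2)
    (h3 : k * z ^ 2 = k' * z' ^ 2) :
    parabElt M k x z h = parabElt M k' x' z' h' :=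
  gamma0_eq_of_coe_eq (by simp only [coe_parabElt, coe_unipSL, unipMat, h1, h2, h3])

omit [NeZero p] in
/-- **`Ψ̄(u(k; px, z)) = Ψ̄(u(k; x, z))`** for `p ≡ 1 (mod N/3)`, `p ∤ z` (transport of the cusp `x/z ↦ px/z`
inside `Γ₀(N/3)`). [cite: Shimura1971, §1.3 and Prop. 1.43] -/
theorem mkQ_liftedSymbol_parabElt_mul_fst (hq : ((N / 3 : ℕ) : ℤ) ∣ (p : ℤ) - 1) (k x z : ℤ) (hxz : IsCoprime x z)
    (hpz : IsCoprime (p : ℤ) z) (h : ((N / 3 : ℕ) : ℤ) ∣ k * z ^ 2) :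
    (shiftSubOneLattice N h9).mkQ (liftedSymbol N h9 (parabElt (N / 3) k ((p : ℤ) * x) z h)) =
      (shiftSubOneLattice N h9).mkQ (liftedSymbol N h9 (parabElt (N / 3) k x z h)) := by
  obtain ⟨g, hg0, hg1⟩ := exists_gamma0_vec_eq_mul_fst hq x z hxz hpz
  have h' := dvd_mul_sq_of_mem g (x := x) h
  have e : parabElt (N / 3) k ((p : ℤ) * x) z h =
      parabElt (N / 3) k ((g : SL(2, ℤ)) 0 0 * x + (g : SL(2, ℤ)) 0 1 * z)
        ((g : SL(2, ℤ)) 1 0 * x + (g : SL(2, ℤ)) 1 1 * z) h' :=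
    gamma0_eq_of_coe_eq (by simp only [coe_parabElt, coe_unipSL, hg0, hg1])
  rw [e]
  exact mkQ_liftedSymbol_parabElt_smul N h9 g k x z h h'

omit [NeZero p] in
/-- **`Ψ̄(u(k; x, pz)) = Ψ̄(u(k; x, z))`** for `p ≡ 1 (mod N/3)`, `p ∤ x` (transport `x/z ↦ x/(pz)`).
[cite: Shimura1971, §1.3 and Prop. 1.43] -/
theorem mkQ_liftedSymbol_parabElt_mul_snd (hq : ((N / 3 : ℕ) : ℤ) ∣ (p : ℤ) - 1) (k x z : ℤ) (hxz : IsCoprime x z)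
    (hpx : IsCoprime (p : ℤ) x) (h : ((N / 3 : ℕ) : ℤ) ∣ k * z ^ 2) (h' : ((N / 3 : ℕ) : ℤ) ∣ k * ((p : ℤ) * z) ^ 2) :
    (shiftSubOneLattice N h9).mkQ (liftedSymbol N h9 (parabElt (N / 3) k x ((p : ℤ) * z) h')) =
      (shiftSubOneLattice N h9).mkQ (liftedSymbol N h9 (parabElt (N / 3) k x z h)) := by
  obtain ⟨g, hg0, hg1⟩ := exists_gamma0_vec_eq_mul_snd hq x z hxz hpx
  have h'' := dvd_mul_sq_of_mem g (x := x) h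
  have e : parabElt (N / 3) k x ((p : ℤ) * z) h' =
      parabElt (N / 3) k ((g : SL(2, ℤ)) 0 0 * x + (g : SL(2, ℤ)) 0 1 * z)
        ((g : SL(2, ℤ)) 1 0 * x + (g : SL(2, ℤ)) 1 1 * z) h'' :=
    gamma0_eq_of_coe_eq (by simp only [coe_parabElt, coe_unipSL, hg0, hg1])
  rw [e]
  exact mkQ_liftedSymbol_parabElt_smul N h9 g k x z h h''

/-- `p + 1 = #I_p(L)` for `p ∤ L` (plumbing). [cite: DiamondShurman2005, Prop. 5.2.1] -/
private theorem card_heckeIdx' {L : ℕ} (hpL : ¬p ∣ L) : Fintype.card (HeckeIdx L p) = p + 1 := by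
  rw [Fintype.card_congr (Equiv.subtypeUnivEquiv fun (i : Option (ZMod p)) (_ : i = none) ↦ hpL),
    Fintype.card_option, ZMod.card]

set_option maxHeartbeats 400000 in
include hp in
/-- **The trace identity for the parabolic elements `u(k; x, z) ∈ Γ₀(N/3)`** (`p ≡ 1 (mod N/3)`,
`p ≡ 1 (mod 3)`, `p ∤ N/3`, `(x, z)` coprime): `∑_{l ∈ I_p(N/3)} Ψ(u'_l) − 2Ψ(u) ∈ Λ₁`.
If `p ∣ k`, `σ_u = id` and every `u'_l` is a conjugate `u(k/p; ·)` whose class is `Ψ̄(u)` (`p + 1 ≡ 2 (mod 3)`,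
`3Ψ̄(u) = 0`); if `p ∤ k`, `σ_u` is a transvection on `ℙ¹(𝔽_p)` with one fixed coset (class `Ψ̄(u(kp; ·)) = Ψ̄(u)`)
and one orbit of size `p` contributing `Ψ̄((uᵖ)'_l) = Ψ̄(u)`; all identifications of classes are transports of
cusps inside `Γ₀(N/3)` (`p ≡ 1`), `T`-conjugations, and `Ψ̄(u(qk)) = Ψ̄(u(k))` for `q ≡ 1 (mod 3)`.
[cite: Knapp1993, Prop. 11.23 proof (PDF pp. 244–245)] [cite: Shimura1971, §1.3, Prop. 1.43 and §8.3 p. 237] -/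
theorem sum_liftedSymbol_heckePermElt_sub_two_smul_mem_parabElt (hpM : ¬p ∣ N / 3)
    (hq : ((N / 3 : ℕ) : ℤ) ∣ (p : ℤ) - 1) (hp1 : p % 3 = 1) (k x z : ℤ) (hxz : IsCoprime x z)
    (h : ((N / 3 : ℕ) : ℤ) ∣ k * z ^ 2) :
    ∑ l : HeckeIdx (N / 3) p, liftedSymbol N h9 (heckePermElt hp (parabElt (N / 3) k x z h) l) -
        2 • liftedSymbol N h9 (parabElt (N / 3) k x z h) ∈ shiftSubOneLattice N h9 := by
  classical
  haveI : Fact p.Prime := ⟨hp⟩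
  have hp' : Prime (p : ℤ) := Nat.prime_iff_prime_int.mp hp
  have hcop : IsCoprime ((N / 3 : ℕ) : ℤ) (p : ℤ) :=
    Nat.isCoprime_iff_coprime.mpr ((Nat.Prime.coprime_iff_not_dvd hp).mpr hpM).symm
  have h3 : (3 : ℤ) ∣ (p : ℤ) - 1 :=
    ⟨((p / 3 : ℕ) : ℤ), by have := Nat.div_add_mod p 3; rw [hp1] at this; omega⟩
  have h3' : (3 : ℤ) ∣ (p : ℤ) ^ 2 - 1 := by
    obtain ⟨r, hr⟩ := h3; exact ⟨r * (p + 1), by linear_combination ((p : ℤ) + 1) * hr⟩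
  have hn : (none : Option (ZMod p)) = none → ¬p ∣ N / 3 := fun _ ↦ hpM
  have hcard : Fintype.card (HeckeIdx (N / 3) p) = p + 1 := card_heckeIdx' hpM
  rw [sum_liftedSymbol_heckePermElt_sub_two_smul_mem_iff]
  set c := (shiftSubOneLattice N h9).mkQ (liftedSymbol N h9 (parabElt (N / 3) k x z h)) with hc
  have h3c : 3 • c = 0 := three_nsmul_mkQ_liftedSymbol_parabElt N h9 k x z h
  -- notation-free helpers: scaling by `p` and `p²`
  have scale : ∀ (k' x' z' : ℤ) (h₀ : ((N / 3 : ℕ) : ℤ) ∣ k' * z' ^ 2) (h₁ : ((N / 3 : ℕ) : ℤ) ∣ (p : ℤ) * k' * z' ^ 2),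
      (shiftSubOneLattice N h9).mkQ (liftedSymbol N h9 (parabElt (N / 3) ((p : ℤ) * k') x' z' h₁)) =
        (shiftSubOneLattice N h9).mkQ (liftedSymbol N h9 (parabElt (N / 3) k' x' z' h₀)) :=
    fun k' x' z' h₀ h₁ ↦ mkQ_liftedSymbol_parabElt_mul_of_mod_three N h9 h3 k' x' z' h₀
  have scale2 : ∀ (k' x' z' : ℤ) (h₀ : ((N / 3 : ℕ) : ℤ) ∣ k' * z' ^ 2)
      (h₁ : ((N / 3 : ℕ) : ℤ) ∣ (p : ℤ) ^ 2 * k' * z' ^ 2),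
      (shiftSubOneLattice N h9).mkQ (liftedSymbol N h9 (parabElt (N / 3) ((p : ℤ) ^ 2 * k') x' z' h₁)) =
        (shiftSubOneLattice N h9).mkQ (liftedSymbol N h9 (parabElt (N / 3) k' x' z' h₀)) :=
    fun k' x' z' h₀ h₁ ↦ mkQ_liftedSymbol_parabElt_mul_of_mod_three N h9 h3' k' x' z' h₀
  by_cases hk : (p : ℤ) ∣ k
  · /- Case `p ∣ k`: `σ = id`, all `p + 1` terms equal `c`. -/
    obtain ⟨k₁, rfl⟩ := hk
    have hk₁ : ((N / 3 : ℕ) : ℤ) ∣ k₁ * z ^ 2 :=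
      hcop.dvd_of_dvd_mul_left (by rw [show (p : ℤ) * (k₁ * z ^ 2) = (p : ℤ) * k₁ * z ^ 2 by ring]; exact h)
    have hc₁ : c = (shiftSubOneLattice N h9).mkQ (liftedSymbol N h9 (parabElt (N / 3) k₁ x z hk₁)) :=
      scale k₁ x z hk₁ h
    have hall : ∀ l : HeckeIdx (N / 3) p, (shiftSubOneLattice N h9).mkQ
        (liftedSymbol N h9 (heckePermElt hp (parabElt (N / 3) ((p : ℤ) * k₁) x z h) l)) = c := by
      intro l
      obtain ⟨_ | j, hl⟩ := l
      · -- `∞`: `u'_∞ = u(k₁; px, z)`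
        obtain ⟨-, hh⟩ := heckePerm_parabElt_mul_none hp k₁ x z h hl hk₁
        rw [hh, hc₁]
        by_cases hpz : (p : ℤ) ∣ z
        · obtain ⟨z₁, rfl⟩ := hpz
          have hpx : IsCoprime (p : ℤ) x := (Prime.coprime_iff_not_dvd hp').mpr fun hx ↦
            hp'.not_unit (hxz.isUnit_of_dvd' hx (dvd_mul_right _ _))
          have hz₁ : ((N / 3 : ℕ) : ℤ) ∣ k₁ * z₁ ^ 2 :=
            hcop.dvd_of_dvd_mul_left (hcop.dvd_of_dvd_mul_left
              (by rw [show (p : ℤ) * ((p : ℤ) * (k₁ * z₁ ^ 2)) = k₁ * ((p : ℤ) * z₁) ^ 2 by ring]; exact hk₁))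
          have hxz₁ : IsCoprime x z₁ := hxz.of_mul_right_right
          -- `u(k₁; px, pz₁) = u(p²k₁; x, z₁)`
          rw [parabElt_eq_of hk₁ ((p : ℤ) ^ 2 * k₁) x z₁ (dvd_mul_mul_sq ((p : ℤ) ^ 2) hz₁) (by ring) (by ring) (by ring),
            scale2 k₁ x z₁ hz₁, ← mkQ_liftedSymbol_parabElt_mul_snd N h9 hq k₁ x z₁ hxz₁ hpx hz₁ hk₁]
        · exact mkQ_liftedSymbol_parabElt_mul_fst N h9 hq k₁ x z hxz ((Prime.coprime_iff_not_dvd hp').mpr hpz) hk₁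
      · -- `j`: `u'_j = u(k₁; x + jz, pz)`
        have hpz2 : ((N / 3 : ℕ) : ℤ) ∣ k₁ * ((p : ℤ) * z) ^ 2 := by
          rw [show k₁ * ((p : ℤ) * z) ^ 2 = (p : ℤ) * k₁ * z ^ 2 * p by ring]; exact Dvd.dvd.mul_right h _
        obtain ⟨-, hh⟩ := heckePerm_parabElt_mul_some hp k₁ x z h j hl hpz2
        rw [hh, hc₁]
        have hxjz : IsCoprime (x + (j.val : ℤ) * z) z := hxz.add_mul_right_left _
        by_cases hpj : (p : ℤ) ∣ x + (j.val : ℤ) * z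
        · obtain ⟨y₀, hy⟩ := hpj
          have hpz : ¬(p : ℤ) ∣ z := fun hz ↦ hp'.not_unit (hxz.isUnit_of_dvd'
            (by have := dvd_sub ⟨y₀, hy⟩ (Dvd.dvd.mul_left hz (j.val : ℤ)); rwa [add_sub_cancel_right] at this) hz)
          have hy₀z : IsCoprime y₀ z := by
            rw [hy] at hxjz; exact hxjz.of_mul_left_right
          -- `u(k₁; py₀, pz) = u(p²k₁; y₀, z)`, class `= Ψ̄(u(k₁; y₀, z)) = Ψ̄(u(k₁; py₀, z)) = Ψ̄(u(k₁; x + jz, z))`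
          rw [parabElt_eq_of hpz2 ((p : ℤ) ^ 2 * k₁) y₀ z (dvd_mul_mul_sq ((p : ℤ) ^ 2) hk₁)
              (by rw [hy]; ring) (by rw [hy]; ring) (by ring),
            scale2 k₁ y₀ z hk₁, ← mkQ_liftedSymbol_parabElt_mul_fst N h9 hq k₁ y₀ z hy₀z
              ((Prime.coprime_iff_not_dvd hp').mpr hpz) hk₁,
            parabElt_eq_of (x := (p : ℤ) * y₀) hk₁ k₁ (x + (j.val : ℤ) * z) z hk₁ (by rw [hy]) (by rw [hy]) rfl,
            mkQ_liftedSymbol_parabElt_add_mul N h9 (j.val : ℤ) k₁ x z hk₁]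
        · rw [mkQ_liftedSymbol_parabElt_mul_snd N h9 hq k₁ (x + (j.val : ℤ) * z) z hxjz
              ((Prime.coprime_iff_not_dvd hp').mpr hpj) hk₁ hpz2,
            mkQ_liftedSymbol_parabElt_add_mul N h9 (j.val : ℤ) k₁ x z hk₁]
    rw [Finset.sum_congr rfl (fun l _ ↦ hall l), Finset.sum_const, Finset.card_univ, hcard]
    have hp3 : p + 1 = 3 * (p / 3) + 2 := by have := Nat.div_add_mod p 3; rw [hp1] at this; omega
    rw [hp3, add_nsmul, mul_nsmul, h3c, nsmul_zero, zero_add]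
  · /- Case `p ∤ k`: `σ` is a transvection; one fixed coset and one orbit of size `p`. -/
    have hpk : ((N / 3 : ℕ) : ℤ) ∣ (p : ℤ) * k * z ^ 2 := dvd_mul_mul_sq _ h
    have hep : parabElt (N / 3) k x z h ^ p = parabElt (N / 3) ((p : ℤ) * k) x z hpk := by rw [parabElt_pow]
    have hpz2 : ((N / 3 : ℕ) : ℤ) ∣ k * ((p : ℤ) * z) ^ 2 := by
      rw [show k * ((p : ℤ) * z) ^ 2 = (p : ℤ) * k * z ^ 2 * p by ring]; exact Dvd.dvd.mul_right hpk _
    have hσp : (heckePermEquiv hp (parabElt (N / 3) k x z h)) ^ p = 1 := by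
      refine Equiv.ext fun l ↦ ?_
      rw [Equiv.Perm.one_apply, ← heckePerm_pow, hep]
      obtain ⟨_ | j, hl⟩ := l
      · exact (heckePerm_parabElt_mul_none hp k x z hpk hl h).1
      · exact (heckePerm_parabElt_mul_some hp k x z hpk j hl hpz2).1
    have sum_orbit : ∀ l₁ : HeckeIdx (N / 3) p, ∑ i ∈ Finset.range p, (shiftSubOneLattice N h9).mkQ
        (liftedSymbol N h9 (heckePermElt hp (parabElt (N / 3) k x z h)
          (((heckePermEquiv hp (parabElt (N / 3) k x z h)) ^ i) l₁))) =
        (shiftSubOneLattice N h9).mkQ (liftedSymbol N h9 (heckePermElt hp (parabElt (N / 3) ((p : ℤ) * k) x z hpk) l₁)) :=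
      fun l₁ ↦ by rw [← mkQ_liftedSymbol_heckePermElt_pow, hep]
    by_cases hpz : (p : ℤ) ∣ z
    · -- `p ∣ z`, `z = p z₁`: `∞` is fixed, `j = 0` is moved
      obtain ⟨z₁, rfl⟩ := hpz
      have hpx' : ¬(p : ℤ) ∣ x := fun hx ↦ hp'.not_unit (hxz.isUnit_of_dvd' hx (dvd_mul_right _ _))
      have hpx : IsCoprime (p : ℤ) x := (Prime.coprime_iff_not_dvd hp').mpr hpx'
      have hxz₁ : IsCoprime x z₁ := hxz.of_mul_right_right
      have hz₁ : ((N / 3 : ℕ) : ℤ) ∣ k * z₁ ^ 2 :=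
        hcop.dvd_of_dvd_mul_left (hcop.dvd_of_dvd_mul_left
          (by rw [show (p : ℤ) * ((p : ℤ) * (k * z₁ ^ 2)) = k * ((p : ℤ) * z₁) ^ 2 by ring]; exact h))
      have hkpz₁ : ((N / 3 : ℕ) : ℤ) ∣ k * (p : ℤ) * z₁ ^ 2 := by
        rw [show k * (p : ℤ) * z₁ ^ 2 = (p : ℤ) * k * z₁ ^ 2 by ring]; exact dvd_mul_mul_sq _ hz₁
      obtain ⟨hσ0, hh0⟩ := heckePerm_parabElt_none_fixed hp k x z₁ h hn hkpz₁
      have h0 : (some (0 : ZMod p) : Option (ZMod p)) = none → ¬p ∣ N / 3 := fun h ↦ (Option.some_ne_none _ h).elim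
      have hmoved : heckePermEquiv hp (parabElt (N / 3) k x ((p : ℤ) * z₁) h) ⟨some 0, h0⟩ ≠ ⟨some 0, h0⟩ := by
        intro hfix
        rw [heckePermEquiv_apply] at hfix
        have hd := dvd_quadratic_of_heckePerm_some_eq_self hp _ 0 h0 hfix
        simp only [coe_parabElt, coe_unipSL, unipMat, ZMod.val_zero, Nat.cast_zero, Matrix.of_apply,
          Matrix.cons_val', Matrix.cons_val_zero, Matrix.cons_val_one, Matrix.cons_val_fin_one] at hd
        have : (p : ℤ) ∣ k * x ^ 2 := by
          have h' := dvd_neg.mpr hd; ring_nf at h' ⊢; exact h'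
        rcases hp'.dvd_or_dvd this with h1 | h1
        · exact hk h1
        · exact hpx' (hp'.dvd_of_dvd_pow h1)
      rw [sum_eq_add_sum_range_of_pow_prime_eq_one (heckePermEquiv hp (parabElt (N / 3) k x ((p : ℤ) * z₁) h)) hp hσp
        hcard (l₀ := ⟨none, hn⟩) (l₁ := ⟨some 0, h0⟩) ((heckePermEquiv_apply hp _ _).trans hσ0) hmoved]
      rw [sum_orbit, hh0, (heckePerm_parabElt_mul_some hp k x ((p : ℤ) * z₁) hpk 0 h0 hpz2).2]
      -- first term: `Ψ̄(u(kp; x, z₁)) = Ψ̄(u(k; x, z₁)) = Ψ̄(u(k; x, pz₁)) = c`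
      rw [parabElt_eq_of hkpz₁ ((p : ℤ) * k) x z₁ (dvd_mul_mul_sq (p : ℤ) hz₁) (by ring) (by ring) (by ring),
        scale k x z₁ hz₁, ← mkQ_liftedSymbol_parabElt_mul_snd N h9 hq k x z₁ hxz₁ hpx hz₁ h]
      -- second term: `Ψ̄(u(k; x + 0, p(pz₁))) = Ψ̄(u(k; x, pz₁)) = c`
      simp only [ZMod.val_zero, Nat.cast_zero, zero_mul, add_zero]
      rw [mkQ_liftedSymbol_parabElt_mul_snd N h9 hq k x ((p : ℤ) * z₁) hxz hpx h hpz2, two_nsmul]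
    · -- `p ∤ z`: the fixed coset is `j₀ = −x/z`, `∞` is moved
      have hpzc : IsCoprime (p : ℤ) z := (Prime.coprime_iff_not_dvd hp').mpr hpz
      have hz0 : ((z : ℤ) : ZMod p) ≠ 0 := by
        rw [Ne, ZMod.intCast_zmod_eq_zero_iff_dvd]; exact_mod_cast hpz
      set j₀ : ZMod p := -((x : ℤ) : ZMod p) * (((z : ℤ) : ZMod p))⁻¹ with hj₀
      have hj : (some j₀ : Option (ZMod p)) = none → ¬p ∣ N / 3 := fun h ↦ (Option.some_ne_none _ h).elim
      have hdiv : (p : ℤ) ∣ x + (j₀.val : ℤ) * z := by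
        rw [← ZMod.intCast_zmod_eq_zero_iff_dvd]
        push_cast
        rw [ZMod.natCast_zmod_val, hj₀, mul_assoc, inv_mul_cancel₀ hz0, mul_one, add_neg_cancel]
      obtain ⟨y₀, hy⟩ := hdiv
      have hkp : ((N / 3 : ℕ) : ℤ) ∣ k * (p : ℤ) * z ^ 2 := by
        rw [show k * (p : ℤ) * z ^ 2 = (p : ℤ) * k * z ^ 2 by ring]; exact hpk
      obtain ⟨hσ0, hh0⟩ := heckePerm_parabElt_some_fixed hp k x z h j₀ hj y₀ hy hkp
      have hmoved : heckePermEquiv hp (parabElt (N / 3) k x z h) ⟨none, hn⟩ ≠ ⟨none, hn⟩ := by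
        intro hfix
        rw [heckePermEquiv_apply] at hfix
        have hd := dvd_apply_one_zero_of_heckePerm_none_eq_self hp _ hn hfix
        simp only [coe_parabElt, coe_unipSL, unipMat, Matrix.of_apply, Matrix.cons_val', Matrix.cons_val_zero,
          Matrix.cons_val_one, Matrix.cons_val_fin_one] at hd
        rcases hp'.dvd_or_dvd (dvd_neg.mp hd) with h1 | h1
        · exact hk h1
        · exact hpz (hp'.dvd_of_dvd_pow h1)
      rw [sum_eq_add_sum_range_of_pow_prime_eq_one (heckePermEquiv hp (parabElt (N / 3) k x z h)) hp hσp hcard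
        (l₀ := ⟨some j₀, hj⟩) (l₁ := ⟨none, hn⟩) ((heckePermEquiv_apply hp _ _).trans hσ0) hmoved]
      rw [sum_orbit, hh0, (heckePerm_parabElt_mul_none hp k x z hpk hn h).2]
      -- first term: `Ψ̄(u(kp; y₀, z)) = Ψ̄(u(k; y₀, z)) = Ψ̄(u(k; py₀, z)) = Ψ̄(u(k; x + j₀z, z)) = c`
      have hy₀z : IsCoprime y₀ z := by
        have hxjz : IsCoprime (x + (j₀.val : ℤ) * z) z := hxz.add_mul_right_left _
        rw [hy] at hxjz; exact hxjz.of_mul_left_right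
      have t1 : (shiftSubOneLattice N h9).mkQ (liftedSymbol N h9 (parabElt (N / 3) (k * (p : ℤ)) y₀ z hkp)) = c := by
        have s1 := scale k y₀ z h (dvd_mul_mul_sq (p : ℤ) h)
        have s2 := mkQ_liftedSymbol_parabElt_mul_fst N h9 hq k y₀ z hy₀z hpzc h
        have s3 := mkQ_liftedSymbol_parabElt_add_mul N h9 (j₀.val : ℤ) k x z h
        have e1 : parabElt (N / 3) (k * (p : ℤ)) y₀ z hkp = parabElt (N / 3) ((p : ℤ) * k) y₀ z (dvd_mul_mul_sq (p : ℤ) h) :=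
          parabElt_eq_of (x := y₀) hkp ((p : ℤ) * k) y₀ z (dvd_mul_mul_sq (p : ℤ) h) (by ring) (by ring) (by ring)
        have e2 : parabElt (N / 3) k ((p : ℤ) * y₀) z h = parabElt (N / 3) k (x + (j₀.val : ℤ) * z) z h :=
          parabElt_eq_of (x := (p : ℤ) * y₀) h k (x + (j₀.val : ℤ) * z) z h (by rw [hy]) (by rw [hy]) rfl
        rw [e1, s1, ← s2, e2, s3]
      -- second term: `Ψ̄(u(k; px, z)) = c`
      have t2 : (shiftSubOneLattice N h9).mkQ (liftedSymbol N h9 (parabElt (N / 3) k ((p : ℤ) * x) z h)) = c :=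
        mkQ_liftedSymbol_parabElt_mul_fst N h9 hq k x z hxz hpzc h
      exact (congrArg₂ (· + ·) t1 t2).trans (two_nsmul c).symm

end ParabolicTrace

/-! ### Every parabolic element is some `u(k; x, z)`; the trace identity for `|tr e| ≤ 2`; `E32b` -/

section FixedPointHeckeShift

/-- **Parametrisation of the parabolic elements**: an `e = (a b; c d) ∈ Γ₀(L)` with `tr e = 2` and `c ≠ 0` is
`u(k; x, z)` for some coprime `(x, z)` (`(x : z)` is its fixed cusp): `(a − 1)² = −bc`, and writing
`a − 1 = gx`, `c = gz` with `gcd(x, z) = 1` one finds `z ∣ g`. [cite: Shimura1971, §1.3] -/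
theorem exists_eq_parabElt {L : ℕ} (e : Gamma0 L) (htr : (e : SL(2, ℤ)) 0 0 + (e : SL(2, ℤ)) 1 1 = 2)
    (hc : (e : SL(2, ℤ)) 1 0 ≠ 0) :
    ∃ (k x z : ℤ) (h : (L : ℤ) ∣ k * z ^ 2), IsCoprime x z ∧ e = parabElt L k x z h := by
  obtain ⟨hdet0, hL, -⟩ := coe_mem_delta0_one e
  have hdet : (e : SL(2, ℤ)) 0 0 * (e : SL(2, ℤ)) 1 1 - (e : SL(2, ℤ)) 0 1 * (e : SL(2, ℤ)) 1 0 = 1 := by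
    rw [← Matrix.det_fin_two]; exact hdet0
  set a := (e : SL(2, ℤ)) 0 0 with ha
  set b := (e : SL(2, ℤ)) 0 1 with hb
  set c := (e : SL(2, ℤ)) 1 0 with hc'
  set d := (e : SL(2, ℤ)) 1 1 with hd
  have key : (a - 1) * (a - 1) = -(b * c) := by linear_combination (-1 : ℤ) * hdet + a * htr
  have hg : 0 < Int.gcd (a - 1) c := Int.gcd_pos_of_ne_zero_right _ hc
  obtain ⟨x, z, hcop, hx, hz⟩ := Int.exists_gcd_one hg
  set g : ℤ := (Int.gcd (a - 1) c : ℤ) with hgdef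
  have hg0 : g ≠ 0 := by rw [hgdef]; exact_mod_cast hg.ne'
  have hxz : IsCoprime x z := Int.isCoprime_iff_gcd_eq_one.mpr hcop
  have hz0 : z ≠ 0 := by rintro rfl; rw [zero_mul] at hz; exact hc hz
  -- `x² g = −b z`
  have h1 : x ^ 2 * g = -(b * z) := by
    have : g * (x ^ 2 * g + b * z) = 0 := by
      have := key; rw [hx, hz] at this; linear_combination this
    have := (mul_eq_zero.mp this).resolve_left hg0
    linear_combination this
  -- `z ∣ g`
  have hzg : z ∣ g := (hxz.symm.pow_right (n := 2)).dvd_of_dvd_mul_left ⟨-b, by rw [h1]; ring⟩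
  obtain ⟨k, hk⟩ := hzg
  have hb' : b = -(k * x ^ 2) := by
    have : z * (b + k * x ^ 2) = 0 := by rw [hk] at h1; linear_combination h1
    linear_combination (mul_eq_zero.mp this).resolve_left hz0
  refine ⟨-k, x, z, ?_, hxz, ?_⟩
  · rw [show -k * z ^ 2 = -c by rw [hz, hk]; ring]; exact dvd_neg.mpr hL
  · apply gamma0_eq_of_coe_eq
    ext i j
    fin_cases i <;> fin_cases j <;>
      simp only [coe_parabElt, coe_unipSL, unipMat, Fin.isValue, Fin.zero_eta, Fin.mk_one, Matrix.of_apply,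
        Matrix.cons_val', Matrix.cons_val_zero, Matrix.cons_val_one, Matrix.cons_val_fin_one]
    · change a = _
      linear_combination hx + x * hk
    · change b = _
      linear_combination hb'
    · change c = _
      linear_combination hz + z * hk
    · change d = _
      linear_combination htr - hx - x * hk

variable (N : ℕ) [NeZero N] (h9 : 3 ^ 2 ∣ N) {p : ℕ} [NeZero p] (hp : p.Prime)

include hp in
/-- **The level-`N/3` trace identity** `∑_{l ∈ I_p(N/3)} Ψ(e'_l) − 2Ψ(e) ∈ Λ₁` for every `e ∈ Γ₀(N/3)` with
`|tr e| ≤ 2`, when `p ≡ 1 (mod N/3)`, `p ≡ 1 (mod 3)` and `p ∤ N/3`: the elliptic case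
(`sum_liftedSymbol_heckePermElt_sub_two_smul_mem_of_abs_trace_le_one`), the case `c = 0`, the parabolic case
`e = u(k; x, z)` (`sum_liftedSymbol_heckePermElt_sub_two_smul_mem_parabElt`) and `e = −u` (via `Ψ̄(−1) = 0`).
[cite: Knapp1993, (11.38), Prop. 11.23 and (11.39a) (PDF p. 244)] [cite: Shimura1971, §1.3 and §8.3 p. 237] -/
theorem sum_liftedSymbol_heckePermElt_sub_two_smul_mem_of_abs_trace_le_two (hpM : ¬p ∣ N / 3)
    (hq : ((N / 3 : ℕ) : ℤ) ∣ (p : ℤ) - 1) (hp1 : p % 3 = 1) (e : Gamma0 (N / 3))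
    (he : |(e : SL(2, ℤ)) 0 0 + (e : SL(2, ℤ)) 1 1| ≤ 2) :
    ∑ l : HeckeIdx (N / 3) p, liftedSymbol N h9 (heckePermElt hp e l) - 2 • liftedSymbol N h9 e ∈
      shiftSubOneLattice N h9 := by
  have hp2 : p ≠ 2 := by rintro rfl; norm_num at hp1
  by_cases hc : (e : SL(2, ℤ)) 1 0 = 0
  · exact sum_liftedSymbol_heckePermElt_sub_two_smul_mem_of_apply_one_zero N h9 hp hc
  by_cases he1 : |(e : SL(2, ℤ)) 0 0 + (e : SL(2, ℤ)) 1 1| ≤ 1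
  · exact sum_liftedSymbol_heckePermElt_sub_two_smul_mem_of_abs_trace_le_one N h9 hp hp2 hp1 hpM e he1
  have htr : (e : SL(2, ℤ)) 0 0 + (e : SL(2, ℤ)) 1 1 = 2 ∨ (e : SL(2, ℤ)) 0 0 + (e : SL(2, ℤ)) 1 1 = -2 := by
    rcases abs_le.mp he with ⟨h1, h2⟩
    rw [not_le] at he1
    rcases lt_abs.mp he1 with h3 | h3 <;> omega
  rcases htr with htr | htr
  · obtain ⟨k, x, z, h, hxz, rfl⟩ := exists_eq_parabElt e htr hc
    exact sum_liftedSymbol_heckePermElt_sub_two_smul_mem_parabElt N h9 hp hpM hq hp1 k x z hxz h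
  · -- `e = (−1)·e'` with `tr e' = 2`
    set n : Gamma0 (N / 3) := ⟨-1, by rw [Gamma0_mem]; simp⟩ with hn
    have hn2 : n * n = 1 := Subtype.ext (by rw [Subgroup.coe_mul, hn, Subgroup.coe_one]; simp)
    set e' : Gamma0 (N / 3) := n * e with he'
    have hee : e = n * e' := by rw [he', ← mul_assoc, hn2, one_mul]
    have he'c : ∀ i j, (e' : SL(2, ℤ)) i j = -(e : SL(2, ℤ)) i j := fun i j ↦ by
      rw [he', Subgroup.coe_mul, hn]; simp
    have htr' : (e' : SL(2, ℤ)) 0 0 + (e' : SL(2, ℤ)) 1 1 = 2 := by rw [he'c, he'c]; linear_combination -htr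
    have hc' : (e' : SL(2, ℤ)) 1 0 ≠ 0 := by rw [he'c]; exact neg_ne_zero.mpr hc
    obtain ⟨k, x, z, h, hxz, hek⟩ := exists_eq_parabElt e' htr' hc'
    have H' := sum_liftedSymbol_heckePermElt_sub_two_smul_mem_parabElt N h9 hp hpM hq hp1 k x z hxz h
    rw [← hek] at H'
    have hn0 : (n : SL(2, ℤ)) 1 0 = 0 := by rw [hn]; simp
    have hA := sum_liftedSymbol_heckePermElt_mul_sub_mem N h9 hp n e'
    rw [sum_liftedSymbol_heckePermElt_eq_zero_of_apply_one_zero N h9 hp hn0, sub_zero] at hA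
    have hB := liftedSymbol_mul_sub_sub_mem N h9 n e'
    rw [liftedSymbol_eq_zero_of_apply_one_zero N h9 hn0, sub_zero] at hB
    rw [hee]
    have : ∑ l : HeckeIdx (N / 3) p, liftedSymbol N h9 (heckePermElt hp (n * e') l) - 2 • liftedSymbol N h9 (n * e') =
        (∑ l : HeckeIdx (N / 3) p, liftedSymbol N h9 (heckePermElt hp (n * e') l) -
            ∑ l : HeckeIdx (N / 3) p, liftedSymbol N h9 (heckePermElt hp e' l)) +
          (∑ l : HeckeIdx (N / 3) p, liftedSymbol N h9 (heckePermElt hp e' l) - 2 • liftedSymbol N h9 e') -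
          2 • (liftedSymbol N h9 (n * e') - liftedSymbol N h9 e') := by
      rw [smul_sub]; abel
    rw [this]
    exact Submodule.sub_mem _ (Submodule.add_mem _ hA H') (Submodule.smul_of_tower_mem _ 2 hB)

omit [NeZero p] in
include hp in
/-- **`FixedPointSymbolHeckeShift` (route `TameQuarticManinParity`, item E32b)**: for `9 ∣ N`, `p ≠ 3` prime with
`p ≡ 1 (mod N)`, and every `γ = (a b; c d) ∈ Γ₀(N)` with `|3(a + d) − c| ≤ 6` (the fixed-point symbols of the
shift `t = [1, 1/3; 0, 1]`), `(T_p − 2){∞, γ∞} ∈ Λ₁ = (t_* − 1)H₁(X₀(N), ℤ)`.  Proof: `T_p{∞, γ∞} = ∑ᵢ{∞, γ'ᵢ∞}`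
(Knapp (11.38)); `diag(3,1)γdiag(3,1)⁻¹ = T e` with `e ∈ Γ₀(N/3)`, `|tr e| ≤ 2`; modulo `Λ₁` the sum is the trace
`∑_l Ψ̄(e'_l)` over the level-`N/3` cosets, which equals `2Ψ̄(e)` by the orbit analysis of `σ_e` on `ℙ¹(𝔽_p)`
(elliptic: two CM fixed cosets from a norm-`p` element of `ℤ[e]`; parabolic: a transvection, cusps transported
inside `Γ₀(N/3)` using `p ≡ 1`). [cite: Knapp1993, (11.38), Prop. 11.23 and (11.39a) (PDF p. 244)]
[cite: Shimura1971, §1.3 and §8.3 p. 237] [cite: Manin1972, §1.5–1.7] -/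
theorem T_sub_two_smul_symbolInt_mem_shiftSubOneLattice (hp3 : p ≠ 3) (hpN : p ≡ 1 [MOD N]) (γ : Gamma0 N)
    (hγ : |3 * ((γ : SL(2, ℤ)) 0 0 + (γ : SL(2, ℤ)) 1 1) - (γ : SL(2, ℤ)) 1 0| ≤ 6) :
    (HeckeRing0.T N 2 p hp - 2) • symbolInt N γ ∈ shiftSubOneLattice N h9 := by
  haveI : NeZero p := ⟨hp.ne_zero⟩
  have hN1 : N ∣ p - 1 := (Nat.modEq_iff_dvd' hp.one_lt.le).mp hpN.symm
  have h3N : 3 ∣ N := (dvd_pow_self 3 two_ne_zero).trans h9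
  have hMN : N / 3 ∣ N := Nat.div_dvd_of_dvd h3N
  have hp1 : p % 3 = 1 := by
    have := h3N.trans hN1
    have h1 := hp.one_lt
    omega
  have hM1 : N / 3 ∣ p - 1 := hMN.trans hN1
  have hpM : ¬p ∣ N / 3 := by
    intro h
    have h1 : p ∣ p - 1 := h.trans hM1
    have h2 := hp.one_lt
    have : p ≤ p - 1 := Nat.le_of_dvd (by omega) h1
    omega
  have hq : ((N / 3 : ℕ) : ℤ) ∣ (p : ℤ) - 1 := by
    have h := Int.natCast_dvd_natCast.mpr hM1
    rwa [Nat.cast_sub hp.one_lt.le, Nat.cast_one] at h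
  exact T_sub_two_smul_symbolInt_mem_shiftSubOneLattice_of N h9 hp hp3
    (fun e he ↦ sum_liftedSymbol_heckePermElt_sub_two_smul_mem_of_abs_trace_le_two N h9 hp hpM hq hp1 e he) γ hγ

omit [NeZero N] [NeZero p] in
/-- **`FixedPointSymbolHeckeShift`, verbatim in the shape of the route item** (`∀ N [NeZero N] (h9 : 9 ∣ N) p (hp), p ≠ 3 →
p ≡ 1 [MOD N] → ∀ γ, |3(a+d) − c| ≤ 6 → (T_p − 2){∞, γ∞} ∈ Λ₁`). [cite: Knapp1993, (11.38), Prop. 11.23 and (11.39a) (PDF p. 244)] -/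
theorem fixedPointSymbolHeckeShift :
    ∀ (N : ℕ) [NeZero N] (h9 : 3 ^ 2 ∣ N) (p : ℕ) (hp : p.Prime), p ≠ 3 → p ≡ 1 [MOD N] →
      ∀ γ : CongruenceSubgroup.Gamma0 N,
        |3 * ((γ : Matrix.SpecialLinearGroup (Fin 2) ℤ).1 0 0 + (γ : Matrix.SpecialLinearGroup (Fin 2) ℤ).1 1 1) -
            (γ : Matrix.SpecialLinearGroup (Fin 2) ℤ).1 1 0| ≤ 6 →
          (Literature.NumberTheory.EllipticCurves.ModularForms.HeckeRing0.T N 2 p hp -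
              (2 : Literature.NumberTheory.EllipticCurves.ModularForms.HeckeRing0 N 2)) •
              Literature.NumberTheory.ModularSymbols.symbolInt N γ ∈
            Literature.NumberTheory.ModularSymbols.shiftSubOneLattice N h9 :=
  fun N _ h9 _ hp hp3 hpN γ hγ ↦ T_sub_two_smul_symbolInt_mem_shiftSubOneLattice N h9 hp hp3 hpN γ hγ

end FixedPointHeckeShift

end Literature.NumberTheory.ModularSymbols

end
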